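import Summits.CriticalPhenomena.PercolationContinuityZ3.Theorems.Transplant.SkelPhiRootNegBYTA
import Summits.CriticalPhenomena.PercolationContinuityZ3.Theorems.Transplant.SkelPhiRootBridgeData
import Summits.CriticalPhenomena.PercolationContinuityZ3.Theorems.Transplant.SkelNegBParamsResiduals2
import Summits.CriticalPhenomena.PercolationContinuityZ3.Theorems.Transplant.SkelNegBParamsResidualsA
import Summits.CriticalPhenomena.PercolationContinuityZ3.Theorems.Transplant.SkelNegBParamsRootValsA
import Summits.CriticalPhenomena.PercolationContinuityZ3.Theorems.Transplant.SkelNegBParamsRootValsYA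
import Summits.CriticalPhenomena.PercolationContinuityZ3.Theorems.Transplant.SkelNegBParamsRootCasesT
import Summits.CriticalPhenomena.PercolationContinuityZ3.Theorems.Transplant.SkelNegBParamsRootFineA
import Summits.CriticalPhenomena.PercolationContinuityZ3.Theorems.Transplant.SkelNegBParamsRootFineYA
import Summits.CriticalPhenomena.PercolationContinuityZ3.Theorems.Transplant.SkelNegBParamsRootFineYPA
import Summits.CriticalPhenomena.PercolationContinuityZ3.Theorems.Transplant.SkelNegBParamsRootFineYP2A
import Summits.CriticalPhenomena.PercolationContinuityZ3.Theorems.Transplant.SkelNegBParamsRootFineYQA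
import Summits.CriticalPhenomena.PercolationContinuityZ3.Theorems.Transplant.SkelNegBParamsRootCrossYA
import Summits.CriticalPhenomena.PercolationContinuityZ3.Theorems.Transplant.SkelNegBParamsRootLamA
import Summits.CriticalPhenomena.PercolationContinuityZ3.Theorems.Transplant.SkelNegBParamsRootAA
import Summits.CriticalPhenomena.PercolationContinuityZ3.Theorems.Transplant.SkelNegBParamsRootK
import Summits.CriticalPhenomena.PercolationContinuityZ3.Theorems.Transplant.SkelNegBParamsCorrOK
import Summits.CriticalPhenomena.PercolationContinuityZ3.Theorems.Transplant.SkelNegBParamsSlotsSUA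
import Summits.CriticalPhenomena.PercolationContinuityZ3.Theorems.Transplant.SkelNegBParamsSlotsT
import Summits.CriticalPhenomena.PercolationContinuityZ3.Theorems.Transplant.SkelNegBParamsSlots
import HarnessLib

/-!
# N1 (the `{±1}` node), (R) column under (ζ′) + the L closure (instantiation, y-directions): **THE ROOT RESIDUE AT EVERY y-DIRECTION AT THE (ζ′)
# VALUES** — `NegB.rootOblTWAt_negBTA_y_exA`: `Skel.RootOblTWAt G ((choiceAtOTA κ Φ t p (KS.gT 0 gx) (KS.fT 0 fx) (SUA exA mx) hC (KS.PR 0 Px)).scheme O q) Φ.Δ κ.δr du`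
# for `du.1 = 1`, from `AtQO`, one vertex type, `0 < p < 1`, the FLAT ROOT TABLE `FlatL NegB.LfA κ` of the L closure, the two `×Kq` floors `hnA`/`hMA`
# (`2000·Kq·(RA′+2) ≤ n_L`, `22000·Kq·(RA′+2) ≤ M_L`) and the box-residual floor `64·(n_b + ℓ_b + |h_b|) ≤ M_L` — all three discharged at
# `gx := KS.gxA c`, `fx := KS.fxA` by `KS.nL_floorsA.1` / `KS.ML_floorsA.1` / `KS.ML_floorsA.2.1` (stmt-g16, ResidualsA) in the glue `SkelNeg1RootHoldsA`.
# A-twin of `SkelNeg1RootHoldsY` (p3-g10, `rootOblTWAt_negBT_y_exR2`): the same three legs (hop of side `σu` → bridge → x-prefix of `3 + 1` windows →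
# y′-run of `NyOfA + 1` drifting windows) in the same three bridge-orientation cases over `rootOblTWAt_negBTA_y` (SkelPhiRootNegBYTA), every served
# number read from stmt-g16's (ζ′) ledger — `KS.NyOfA_spec` (`0+1+3+1+Ny ≤ 1000·Kq`, whence `≤ LfA κ.K₀ = 2000·Kq`), x-prefix readings
# `KS.hPfX₁σ_RA/hPfX₂σ_RA/hPfX₃_RA` (RootFineYP2A/YPA), y′-region readings `KS.hQfY_lev_RA/hQfY₃_RA` (RootFineYQA), last-core readings `KS.hLgY*_RA`
# (RootFineYA), clearance / reach `KS.hclrY_RA/hπ3_RA` (RootCrossYA, reach budget `exA`), `KS.hkR0_RA/hkR1_RA/hfR_RA` (RootLamA), `hkA0_RA/hkA1_RA/KS.hkAQ_TA`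
# (RootAA), `hRQ_RA/hRB_RA/hRQ'_RA/hRM_RA`, `ex_le_RπA/fat_le_RπA/Rex_fat_le_RπA_sub/E₀_SUA_eq` (SlotsSUA; `le_Rπ_of` is slot-generic), `floors_exA/floorsK_exA` (ResidualsA);
# the cell-free lemmas of record are reused as they stand (stmt-g16 04:40:05Z: `σuOf*`, `hx₂₃_R` — its floor `2000(RA′+2) ≤ n_L` from `KS.nL_floorsT` at any
# `fx` —, `yYof/ρY_bounds/Λ₀of_yYof/abs_Λ₁of_yYof/yYof_l1/hregY_R/hlastcY_R`, `KS.yLs/yLd/yLt`, `qBs/qBd/qBt`, `hclr_*`, `hxa_*`, `hxb_*`, `four_qB*_le`,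
# `Λ_sdt`, `Λ₀_sdt_sharp`, `frames_B₀_eq`, `region_eq_tr`, `bridgeData_*`, `MB_floorsR`, `RF2_R`, `clauseBR_of_atQOS`, `bridge_mem_PR`, `kit_mem_PR`,
# `hprism_R`, `hΛQ_R`, `hΛR_R`, `hΛRg_of_atQOS`, `hclr₁_R`, `hB0_R`, `hRn_R`, `layer_T`, `hclrz_T`, `core1Lo_l1`, `yL_l1`).  The y′-leg's reach uses
# `(Ny+1)·U ≤ 1000·Kq·U` against `floorsK_exA.1`.

builds on p205010 (kernel theorem, internal audit signed; external expert review pending) — nothing in this file uses p205010; NOTHING is claimed about the open node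
`SamePDropOfSkeletonNeg₁` beyond this (R) residue at the y-directions of the (ζ′) tuple.
Lane `prim-bschramm`, seat `prim-bschramm-p3` (gen 12; design owner + (R) owner); helper file (`--supports stmt-CriticalPhenomena-4575 --as helper`).
[cite: KozmaNitzan2024, §4 Theorem 6 (pp. 25–31), p. 28 ((32) at the root), Lemma 10–12 (pp. 17–25)] [cite: MartineauTassion2017, §3.2, §4.3]
-/

noncomputable section

open scoped Classical

namespace Summit.CriticalPhenomena.PercolationContinuityZ3.Theorems.Transplant

open MeasureTheory Literature.Probability.Percolation Literature.Probability.LatticeModels SimpleGraph KNCells KNLevels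
open Literature.Probability.Percolation.KozmaNitzan.Cells (oth sgOf sgOf_sign stepVec_apply_fst)
open Literature.Barriers.CriticalPhenomena (graphBall mem_graphBall_self graphBall_mono)

namespace PlanarSkeletonNeg

open SkelConc (Consts)
open Skelφ (oriφ trφ rootFrame pgramPrismFin pgSideHalfW pgTopPieceW)
open Skelφ.StepI (DataN OutO eventNAt)

namespace NegB

open Neg

section AtR

variable {κ : Consts} {V : Type} [DecidableEq V] [Countable V] {G : SimpleGraph V} [G.LocallyFinite] {Φ : PlanarSkeletonNeg G} {t : V} {p : unitInterval}
  {hC : Φ.CylSubcritical p} (gx fx : Neg.FSlot) (Px : PSlot) (mx : GSlot) {O : OutO V} {q : unitInterval}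

set_option maxHeartbeats 1600000 in
/-- **THE ROOT RESIDUE AT EVERY y-DIRECTION AT THE (ζ′) VALUES, flat root table** (residual floor `exA`; any `gx fx Px mx` meeting the two `×Kq` floors
and the `M_L` floor; see the module docstring). [cite: KozmaNitzan2024, §4 p. 28 ((32) at the root)] -/
theorem rootOblTWAt_negBTA_y_exA (hAt : (choiceAtOTA κ Φ t p (KS.gT 0 gx) (KS.fT 0 fx) (SUA exA mx) hC (KS.PR 0 Px)).AtQO O q) (h1 : Φ.types = {t})
    (hp0 : 0 < (p : ℝ)) (hp1 : (p : ℝ) < 1) (hflat : FlatL LfA κ) (du : MDir) (hd : du.1 = 1)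
    -- the two `×Kq` floors of the (ζ′) tuple (`KS.nL_floorsA.1`, `KS.ML_floorsA.1` at `fxA` / `gxA c`) and the box-residual floor (`KS.ML_floorsA.2.1`)
    (hnA : 2000 * Neg.Kq κ * (KS.RA' κ Φ t p O.merged 0 + 2) ≤ nL κ Φ t p O.merged (KS.gT 0 gx κ Φ t p O.merged) (KS.fT 0 fx κ Φ t p O.merged))
    (hMA : 22000 * Neg.Kq κ * (KS.RA' κ Φ t p O.merged 0 + 2) ≤ ML κ Φ t p O.merged (KS.gT 0 gx κ Φ t p O.merged))
    (hS64 : 64 * (KS.nBR κ Φ t p O.merged 0 + KS.ℓBR κ Φ t p O.merged 0 + (KS.hBR κ Φ t p O.merged 0).natAbs) ≤ ML κ Φ t p O.merged (KS.gT 0 gx κ Φ t p O.merged)) :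
    Skel.RootOblTWAt G ((choiceAtOTA κ Φ t p (KS.gT 0 gx) (KS.fT 0 fx) (SUA exA mx) hC (KS.PR 0 Px)).scheme O q) Φ.Δ κ.δr du := by
  obtain ⟨i, sδ⟩ := du
  change i = 1 at hd
  subst hd
  have hfloors := floors_exA κ Φ t p O.merged (KS.gT 0 gx κ Φ t p O.merged) (KS.fT 0 fx κ Φ t p O.merged)
  have hfloorsK := (floorsK_exA κ Φ t p O.merged (KS.gT 0 gx κ Φ t p O.merged) (KS.fT 0 fx κ Φ t p O.merged)).1
  -- facts at `AtQO`
  have hAtS := atQOS_of_atQOTA hAt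
  have hAtB := atQOB_of_atQOS hAtS
  obtain ⟨hF, hq1, hq2, hCq⟩ := factsO_of_atQOS hAtS
  obtain ⟨hm₀k, hk1, hkM₀, hReq, hΛeq⟩ := hF.seed
  have hσ : (sgOf ((1 : Fin 2), sδ)) = 1 ∨ (sgOf ((1 : Fin 2), sδ)) = -1 := sgOf_sign _
  have hN : EqNumL κ Φ t p O.merged (KS.gT 0 gx κ Φ t p O.merged) (KS.fT 0 fx κ Φ t p O.merged) := eqNumL_of_atQOS hAtS
  have hκ : (hL κ Φ t p O.merged (KS.gT 0 gx κ Φ t p O.merged) (KS.fT 0 fx κ Φ t p O.merged)).natAbs ≤ 10 * nL κ Φ t p O.merged (KS.gT 0 gx κ Φ t p O.merged) (KS.fT 0 fx κ Φ t p O.merged) := (clauseL_of_atQOS hAtS).2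
  obtain ⟨hnL, hℓL⟩ := one_le_of_eqNumL κ Φ t p O.merged (KS.gT 0 gx κ Φ t p O.merged) (KS.fT 0 fx κ Φ t p O.merged) hN
  have hv := hN.v_le
  have hlay : ((nL κ Φ t p O.merged (KS.gT 0 gx κ Φ t p O.merged) (KS.fT 0 fx κ Φ t p O.merged) + (hL κ Φ t p O.merged (KS.gT 0 gx κ Φ t p O.merged) (KS.fT 0 fx κ Φ t p O.merged)).natAbs : ℕ) : ℤ) ≤ (nL κ Φ t p O.merged (KS.gT 0 gx κ Φ t p O.merged) (KS.fT 0 fx κ Φ t p O.merged) : ℤ) * ℓL κ Φ t p O.merged (KS.gT 0 gx κ Φ t p O.merged) (KS.fT 0 fx κ Φ t p O.merged) + 1 := by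
    have h := KS.layer_T κ Φ t p O.merged 0 gx (KS.fT 0 fx κ Φ t p O.merged) hN hκ
    have h0 : (0 : ℤ) ≤ ((nL κ Φ t p O.merged (KS.gT 0 gx κ Φ t p O.merged) (KS.fT 0 fx κ Φ t p O.merged) + (hL κ Φ t p O.merged (KS.gT 0 gx κ Φ t p O.merged) (KS.fT 0 fx κ Φ t p O.merged)).natAbs : ℕ) : ℤ) := Int.natCast_nonneg _
    have h1 : (0 : ℤ) ≤ (KS.RA' κ Φ t p O.merged 0 : ℤ) := Int.natCast_nonneg _
    have h2 := mul_le_mul_of_nonneg_right (show (1 : ℤ) ≤ (KS.RA' κ Φ t p O.merged 0 : ℤ) + 3 by linarith) h0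
    linarith
  -- the side of the hop `σu := σ'·sgn⁺ v_L` (B.17 (L-R4))
  have hσu := KS.σuOf_cases κ Φ t p O.merged (KS.gT 0 gx κ Φ t p O.merged) (KS.fT 0 fx κ Φ t p O.merged) hσ
  have hs := KS.σuOf_sign κ Φ t p O.merged (KS.gT 0 gx κ Φ t p O.merged) (KS.fT 0 fx κ Φ t p O.merged) hσ
  obtain ⟨hEb, hκb⟩ := KS.clauseBR_of_atQOS (mk := 0) hAtS
  have hℓb27 : 27 ≤ KS.ℓBR κ Φ t p O.merged 0 := by
    have h := KS.ℓBR_ge κ Φ t p O.merged 0 _ hEb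
    omega
  have hℓb3 : 3 ≤ KS.ℓBR κ Φ t p O.merged 0 := by omega
  have hMB := KS.MB_floorsR κ Φ t p O.merged 0
  have hRF2 := KS.RF2_R κ Φ t p O.merged 0
  have hMzb : Mu O.merged < KS.nBR κ Φ t p O.merged 0 := lt_of_le_of_lt hMB.2.2 hRF2.2.1
  have hnb : 1 ≤ KS.nBR κ Φ t p O.merged 0 := by have := hRF2.2.1; omega
  have hclrb : (Mu O.merged + 4) * (KS.nBR κ Φ t p O.merged 0 + (KS.hBR κ Φ t p O.merged 0).natAbs) ≤ KS.nBR κ Φ t p O.merged 0 * (KS.ℓBR κ Φ t p O.merged 0 + 1) := by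
    have hlay' := hEb.2.2.2.1
    have h1 : Mu O.merged + 4 ≤ KS.MBR κ Φ t p O.merged 0 + 1 := by have := hMB.2.1; omega
    have h2 : ((Mu O.merged + 4 : ℕ) : ℤ) * ((KS.nBR κ Φ t p O.merged 0 + (KS.hBR κ Φ t p O.merged 0).natAbs : ℕ) : ℤ) ≤
        ((KS.MBR κ Φ t p O.merged 0 : ℤ) + 1) * ((KS.nBR κ Φ t p O.merged 0 + (KS.hBR κ Φ t p O.merged 0).natAbs : ℕ) : ℤ) :=
      mul_le_mul_of_nonneg_right (by exact_mod_cast h1) (by positivity)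
    exact_mod_cast h2.trans hlay'
  -- the zone inside a cylinder of the long map
  have hZ : ∀ c, (↑(O.merged.Λ c (Mu O.merged)) : Set V) ⊆ Skelφ.cyl (φL κ Φ t p O.D O.DT O.ori (KS.gT 0 gx κ Φ t p O.merged) (KS.fT 0 fx κ Φ t p O.merged)) c (Mu O.merged) :=
    fun c => by unfold NegB.φL; rw [Skelφ.cyl_oriφ, hΛeq]; exact Skelφ.fatSeq_subset_cyl Φ.frame hC c _
  -- the bridge pair's pieces at every centre, served for `P_q` (both families, all signs), for every inner-chain length `N ≤ 1000·Kq ≤ LfA κ.K₀` (flat root table)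
  have hPb := KS.bridge_mem_PR κ Φ t p O.merged 0 Px
  have hLf : ∀ {N : ℕ}, N ≤ 1000 * Neg.Kq κ → N ≤ LfA κ.K₀ := fun h => h.trans (by rw [LfA_eq]; omega)
  have hδkit : ∀ {N : ℕ}, N ≤ 1000 * Neg.Kq κ → Neg.δI κ Φ ≤ κ.δr N ^ 2 := fun hN' =>
    Neg.δI_le_sq_of_le κ Φ (by rw [hflat _ (hLf hN')]; exact Neg.δkit_le_δr κ Φ (Nat.zero_le _))
  have hservedB : ∀ {N : ℕ}, N ≤ 1000 * Neg.Kq κ → ∀ (c : V) (σ' τ' : ℤ), (σ' = 1 ∨ σ' = -1) → (τ' = 1 ∨ τ' = -1) →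
      1 - κ.δr N ^ 2 < (bondPercolation G q).real (linkIn
        (Skelφ.pgramPrism G (oriφ Φ.φ (O.ori t (KS.MBR κ Φ t p O.merged 0) (KS.nBR κ Φ t p O.merged 0))) c (KS.nBR κ Φ t p O.merged 0) (KS.hBR κ Φ t p O.merged 0)
          (3 * KS.ℓBR κ Φ t p O.merged 0) (Rb κ Φ t p O.merged)) (O.merged.Λ c O.merged.k)
        (pgSideHalfW G (oriφ Φ.φ (O.ori t (KS.MBR κ Φ t p O.merged 0) (KS.nBR κ Φ t p O.merged 0))) c (KS.nBR κ Φ t p O.merged 0) (KS.hBR κ Φ t p O.merged 0)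
          (KS.ℓBR κ Φ t p O.merged 0) (Rb κ Φ t p O.merged) σ' τ')) ∧
      1 - κ.δr N ^ 2 < (bondPercolation G q).real (linkIn
        (Skelφ.pgramPrism G (oriφ Φ.φ (O.ori t (KS.MBR κ Φ t p O.merged 0) (KS.nBR κ Φ t p O.merged 0))) c (KS.nBR κ Φ t p O.merged 0) (KS.hBR κ Φ t p O.merged 0)
          (3 * KS.ℓBR κ Φ t p O.merged 0) (Rb κ Φ t p O.merged)) (O.merged.Λ c O.merged.k)
        (pgTopPieceW G (oriφ Φ.φ (O.ori t (KS.MBR κ Φ t p O.merged 0) (KS.nBR κ Φ t p O.merged 0))) c (KS.nBR κ Φ t p O.merged 0) (KS.hBR κ Φ t p O.merged 0)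
          (KS.ℓBR κ Φ t p O.merged 0) (Rb κ Φ t p O.merged) σ' τ' (KS.vBR κ Φ t p O.merged 0))) := by
    intro N hN' c σ' τ' hσ' hτ'
    have hI := hδkit hN'
    have ha := inputsExtraAt_of_atQOB hAtB h1 c hPb 0 (Skelφ.sgnU σ') (Skelφ.sgnU τ')
    have hb := inputsExtraAt_of_atQOB hAtB h1 c hPb 1 (Skelφ.sgnU σ') (Skelφ.sgnU τ')
    rw [Skelφ.StepI.eventNAt_some] at ha hb
    unfold Skelφ.StepI.regionNAt Skelφ.StepI.pieceNAt at ha hb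
    rw [if_pos rfl, Skelφ.val_sgnU hσ', Skelφ.val_sgnU hτ'] at ha
    rw [if_neg (by decide), Skelφ.val_sgnU hσ', Skelφ.val_sgnU hτ'] at hb
    exact ⟨lt_of_le_of_lt (by linarith) ha, lt_of_le_of_lt (by linarith) hb⟩
  -- the long map in the two orientation cases of the bridge
  have hφcase : O.ori t (KS.MBR κ Φ t p O.merged 0) (KS.nBR κ Φ t p O.merged 0) = oL κ Φ t p O.D O.DT O.ori (KS.gT 0 gx κ Φ t p O.merged) (KS.fT 0 fx κ Φ t p O.merged) ∨
      oriφ Φ.φ (O.ori t (KS.MBR κ Φ t p O.merged 0) (KS.nBR κ Φ t p O.merged 0)) = trφ (φL κ Φ t p O.D O.DT O.ori (KS.gT 0 gx κ Φ t p O.merged) (KS.fT 0 fx κ Φ t p O.merged)) := by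
    unfold NegB.φL
    cases hb : O.ori t (KS.MBR κ Φ t p O.merged 0) (KS.nBR κ Φ t p O.merged 0) <;> cases hl : oL κ Φ t p O.D O.DT O.ori (KS.gT 0 gx κ Φ t p O.merged) (KS.fT 0 fx κ Φ t p O.merged)
    · exact Or.inl rfl
    · exact Or.inr (by rw [Skelφ.oriφ_false, Skelφ.oriφ_true])
    · exact Or.inr (by rw [Skelφ.oriφ_true, Skelφ.oriφ_false, KS.trφ_trφ])
    · exact Or.inl rfl
  -- ### values shared by the three cases
  have hΛ3 := KS.Λ_sdt κ Φ t p O.merged 0 gx fx hN hκ hσu hℓb27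
  have hΛ7 := KS.Λ₀_sdt_sharp κ Φ t p O.merged 0 gx (KS.fT 0 fx κ Φ t p O.merged) hN hκ hS64 hσu hℓb27
  have hq4s := KS.four_qBs_le κ Φ t p O.merged 0 gx fx
  have hq4dt := KS.four_qBdt_le κ Φ t p O.merged 0 gx fx
  have hRQ := hRQ_RA κ Φ t p O.merged (KS.gT 0 gx κ Φ t p O.merged) (KS.fT 0 fx κ Φ t p O.merged) (SUA exA mx) q
  have hRB := hRB_RA κ Φ t p O.merged (KS.gT 0 gx κ Φ t p O.merged) (KS.fT 0 fx κ Φ t p O.merged) (SUA exA mx) q ((1 : Fin 2), sδ)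
  have hRQ' := hRQ'_RA κ Φ t p O.merged (KS.gT 0 gx κ Φ t p O.merged) (KS.fT 0 fx κ Φ t p O.merged) (SUA exA mx) q ((1 : Fin 2), sδ)
  have hRM := hRM_RA κ Φ t p O.merged (KS.gT 0 gx κ Φ t p O.merged) (KS.fT 0 fx κ Φ t p O.merged) (SUA exA mx) q ((1 : Fin 2), sδ)
  have hΛRg := KS.hΛRg_of_atQOS 0 hAtS
  have hkA0 := hkA0_RA κ Φ t p O.merged (KS.gT 0 gx κ Φ t p O.merged) (KS.fT 0 fx κ Φ t p O.merged) hN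
  have hkA1 := hkA1_RA κ Φ t p O.merged (KS.gT 0 gx κ Φ t p O.merged) (KS.fT 0 fx κ Φ t p O.merged) hN
  have hkAQ' := KS.hkAQ_TA κ Φ t p O.merged 0 gx (f := (KS.fT 0 fx κ Φ t p O.merged)) hN hκ hkM₀
  have hρπ := fat_le_RπA κ Φ t p O.merged (KS.gT 0 gx κ Φ t p O.merged) (KS.fT 0 fx κ Φ t p O.merged) exA mx q hC
  have hRlπ : Rl κ Φ t p O.merged (KS.gT 0 gx κ Φ t p O.merged) (KS.fT 0 fx κ Φ t p O.merged) ≤ Rπ κ Φ t p O.merged (KS.gT 0 gx κ Φ t p O.merged) (KS.fT 0 fx κ Φ t p O.merged) (SUA exA mx) q := ex_le_RπA κ Φ t p O.merged (KS.gT 0 gx κ Φ t p O.merged) (KS.fT 0 fx κ Φ t p O.merged) exA mx q hfloors.2.2.1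
  have hΛR := KS.hΛR_R κ Φ t p O.merged (KS.gT 0 gx κ Φ t p O.merged) (KS.fT 0 fx κ Φ t p O.merged) 0 hN hσu
  have hΛQ := KS.hΛQ_R κ Φ t p O.merged (KS.gT 0 gx κ Φ t p O.merged) (KS.fT 0 fx κ Φ t p O.merged) 0
  have hkR0 := KS.hkR0_RA κ Φ t p O.merged (KS.gT 0 gx κ Φ t p O.merged) (KS.fT 0 fx κ Φ t p O.merged) 0 hN
  have hkR1 := KS.hkR1_RA κ Φ t p O.merged (KS.gT 0 gx κ Φ t p O.merged) (KS.fT 0 fx κ Φ t p O.merged) 0 hN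
  have hfR := KS.hfR_RA κ Φ t p O.merged 0 gx (f := (KS.fT 0 fx κ Φ t p O.merged)) hN hκ
  have hRn := KS.hRn_R κ Φ t p O.merged 0 gx fx
  have hRAn := (KS.nL_floorsT κ Φ t p O.merged 0 fx (KS.gT 0 gx κ Φ t p O.merged)).2.1
  have hclr₁ := KS.hclr₁_R κ Φ t p O.merged 0 gx fx hkM₀ (KS.σuOf κ Φ t p O.merged (KS.gT 0 gx κ Φ t p O.merged) (KS.fT 0 fx κ Φ t p O.merged) (sgOf ((1 : Fin 2), sδ)))
  have hB0 := KS.hB0_R κ Φ t p O.merged (KS.gT 0 gx κ Φ t p O.merged) (KS.fT 0 fx κ Φ t p O.merged) 0 (KS.σuOf κ Φ t p O.merged (KS.gT 0 gx κ Φ t p O.merged) (KS.fT 0 fx κ Φ t p O.merged) (sgOf ((1 : Fin 2), sδ)))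
  have hfrB := KS.frames_B₀_eq κ Φ t p O.merged (KS.gT 0 gx κ Φ t p O.merged) (KS.fT 0 fx κ Φ t p O.merged) 0 (KS.σuOf κ Φ t p O.merged (KS.gT 0 gx κ Φ t p O.merged) (KS.fT 0 fx κ Φ t p O.merged) (sgOf ((1 : Fin 2), sδ)))
  have hregB := KS.region_eq_tr κ Φ t p O.merged (KS.gT 0 gx κ Φ t p O.merged) (KS.fT 0 fx κ Φ t p O.merged) 0 (KS.σuOf κ Φ t p O.merged (KS.gT 0 gx κ Φ t p O.merged) (KS.fT 0 fx κ Φ t p O.merged) (sgOf ((1 : Fin 2), sδ)))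
  have hc1 := KS.core1Lo_l1 κ Φ t p O.merged (KS.gT 0 gx κ Φ t p O.merged) (KS.fT 0 fx κ Φ t p O.merged) hσu hℓb27
  have hyl := KS.yL_l1 κ Φ t p O.merged (KS.gT 0 gx κ Φ t p O.merged) (KS.fT 0 fx κ Φ t p O.merged) hσu hℓb27
  have hclrz : (Mu O.merged + 4) * (nL κ Φ t p O.merged (KS.gT 0 gx κ Φ t p O.merged) (KS.fT 0 fx κ Φ t p O.merged) + (hL κ Φ t p O.merged (KS.gT 0 gx κ Φ t p O.merged) (KS.fT 0 fx κ Φ t p O.merged)).natAbs) ≤ nL κ Φ t p O.merged (KS.gT 0 gx κ Φ t p O.merged) (KS.fT 0 fx κ Φ t p O.merged) * (ℓL κ Φ t p O.merged (KS.gT 0 gx κ Φ t p O.merged) (KS.fT 0 fx κ Φ t p O.merged) + 1) := by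
    have h := KS.hclrz_T κ Φ t p O.merged 0 gx (KS.fT 0 fx κ Φ t p O.merged) hN hκ
    have h' : (((Mu O.merged + 4) * (nL κ Φ t p O.merged (KS.gT 0 gx κ Φ t p O.merged) (KS.fT 0 fx κ Φ t p O.merged) + (hL κ Φ t p O.merged (KS.gT 0 gx κ Φ t p O.merged) (KS.fT 0 fx κ Φ t p O.merged)).natAbs) : ℕ) : ℤ) ≤ ((nL κ Φ t p O.merged (KS.gT 0 gx κ Φ t p O.merged) (KS.fT 0 fx κ Φ t p O.merged) * (ℓL κ Φ t p O.merged (KS.gT 0 gx κ Φ t p O.merged) (KS.fT 0 fx κ Φ t p O.merged) + 1) : ℕ) : ℤ) := by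
      push_cast [Int.natCast_natAbs]; linarith
    exact_mod_cast h'
  have hRb₀ : KS.r₀A Φ t O.merged 0 (Rb κ Φ t p O.merged) ≤ Rπ κ Φ t p O.merged (KS.gT 0 gx κ Φ t p O.merged) (KS.fT 0 fx κ Φ t p O.merged) (SUA exA mx) q := ex_le_RπA κ Φ t p O.merged (KS.gT 0 gx κ Φ t p O.merged) (KS.fT 0 fx κ Φ t p O.merged) exA mx q hfloors.1
  have hRr₀ : KS.r₀A Φ t O.merged 0 (Rl κ Φ t p O.merged (KS.gT 0 gx κ Φ t p O.merged) (KS.fT 0 fx κ Φ t p O.merged)) ≤ Rπ κ Φ t p O.merged (KS.gT 0 gx κ Φ t p O.merged) (KS.fT 0 fx κ Φ t p O.merged) (SUA exA mx) q := ex_le_RπA κ Φ t p O.merged (KS.gT 0 gx κ Φ t p O.merged) (KS.fT 0 fx κ Φ t p O.merged) exA mx q hfloors.2.1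
  have hRbπ : Rb κ Φ t p O.merged ≤ Rπ κ Φ t p O.merged (KS.gT 0 gx κ Φ t p O.merged) (KS.fT 0 fx κ Φ t p O.merged) (SUA exA mx) q := ex_le_RπA κ Φ t p O.merged (KS.gT 0 gx κ Φ t p O.merged) (KS.fT 0 fx κ Φ t p O.merged) exA mx q hfloors.2.2.2.1
  have hR₁b := Rex_fat_le_RπA_sub κ Φ t p O.merged (KS.gT 0 gx κ Φ t p O.merged) (KS.fT 0 fx κ Φ t p O.merged) exA mx q hC hfloors.1
  have hR₁r := Rex_fat_le_RπA_sub κ Φ t p O.merged (KS.gT 0 gx κ Φ t p O.merged) (KS.fT 0 fx κ Φ t p O.merged) exA mx q hC hfloors.2.1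
  have hexRπ : exA κ Φ t p O.merged (KS.gT 0 gx κ Φ t p O.merged) (KS.fT 0 fx κ Φ t p O.merged) ≤ Rπ κ Φ t p O.merged (KS.gT 0 gx κ Φ t p O.merged) (KS.fT 0 fx κ Φ t p O.merged) (SUA exA mx) q :=
    le_Rπ_of κ Φ t p O.merged (KS.gT 0 gx κ Φ t p O.merged) (KS.fT 0 fx κ Φ t p O.merged) (SUA exA mx) q (by rw [E₀_SUA_eq]; omega)
  have hbOK := Skelφ.bridgeOK_all hσu (nL κ Φ t p O.merged (KS.gT 0 gx κ Φ t p O.merged) (KS.fT 0 fx κ Φ t p O.merged)) (hL κ Φ t p O.merged (KS.gT 0 gx κ Φ t p O.merged) (KS.fT 0 fx κ Φ t p O.merged)) (ℓL κ Φ t p O.merged (KS.gT 0 gx κ Φ t p O.merged) (KS.fT 0 fx κ Φ t p O.merged)) (KS.RA' κ Φ t p O.merged 0)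
    (KS.nBR κ Φ t p O.merged 0) (KS.hBR κ Φ t p O.merged 0) hℓb3
  -- `n_L ≤ m` (the lattice modulus; `ℓ_L ≥ 2`), for `|Λ₁(yY)| ≤ |Λ₁(yX)| + n_L ≤ 3m`
  have hnm : ((nL κ Φ t p O.merged (KS.gT 0 gx κ Φ t p O.merged) (KS.fT 0 fx κ Φ t p O.merged) : ℕ) : ℤ) ≤ TwoAxis.Para.modulus (nL κ Φ t p O.merged (KS.gT 0 gx κ Φ t p O.merged) (KS.fT 0 fx κ Φ t p O.merged)) (hL κ Φ t p O.merged (KS.gT 0 gx κ Φ t p O.merged) (KS.fT 0 fx κ Φ t p O.merged)) (vL κ Φ t p O.merged (KS.gT 0 gx κ Φ t p O.merged) (KS.fT 0 fx κ Φ t p O.merged)) (Skelφ.NegPrm.vβOf (nL κ Φ t p O.merged (KS.gT 0 gx κ Φ t p O.merged) (KS.fT 0 fx κ Φ t p O.merged)) (hL κ Φ t p O.merged (KS.gT 0 gx κ Φ t p O.merged) (KS.fT 0 fx κ Φ t p O.merged)) (ℓL κ Φ t p O.merged (KS.gT 0 gx κ Φ t p O.merged) (KS.fT 0 fx κ Φ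 t p O.merged)) (vL κ Φ t p O.merged (KS.gT 0 gx κ Φ t p O.merged) (KS.fT 0 fx κ Φ t p O.merged))) := by
    have hm := (Skelφ.NegPrm.modulus_vβOf hnL (hL κ Φ t p O.merged (KS.gT 0 gx κ Φ t p O.merged) (KS.fT 0 fx κ Φ t p O.merged)) (ℓL κ Φ t p O.merged (KS.gT 0 gx κ Φ t p O.merged) (KS.fT 0 fx κ Φ t p O.merged)) (vL κ Φ t p O.merged (KS.gT 0 gx κ Φ t p O.merged) (KS.fT 0 fx κ Φ t p O.merged))).1
    have hℓ2 : (2 : ℤ) ≤ (ℓL κ Φ t p O.merged (KS.gT 0 gx κ Φ t p O.merged) (KS.fT 0 fx κ Φ t p O.merged) : ℤ) := by have h := ℓL_ge κ Φ t p O.merged (KS.gT 0 gx κ Φ t p O.merged) (KS.fT 0 fx κ Φ t p O.merged) hN; omega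
    have hn0 : (0 : ℤ) ≤ (nL κ Φ t p O.merged (KS.gT 0 gx κ Φ t p O.merged) (KS.fT 0 fx κ Φ t p O.merged) : ℤ) := by positivity
    have h2 := mul_le_mul_of_nonneg_left hℓ2 hn0
    linarith
  -- reach numbers inside the window: `X + 1 ≤ exA` via `Yb` (the y′-run at `×Kq`)
  have hπ_of : ∀ {X Nr : ℕ}, X ≤ Yb κ Φ t p O.merged (KS.gT 0 gx κ Φ t p O.merged) (KS.fT 0 fx κ Φ t p O.merged) → 0 + 1 + Nr ≤ 1000 * Neg.Kq κ →
      X + (Nr + 1) * Skelφ.shearUnit (nL κ Φ t p O.merged (KS.gT 0 gx κ Φ t p O.merged) (KS.fT 0 fx κ Φ t p O.merged)) (hL κ Φ t p O.merged (KS.gT 0 gx κ Φ t p O.merged) (KS.fT 0 fx κ Φ t p O.merged)) ≤ Rπ κ Φ t p O.merged (KS.gT 0 gx κ Φ t p O.merged) (KS.fT 0 fx κ Φ t p O.merged) (SUA exA mx) q := by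
    intro X Nr hX hNr
    refine ex_le_RπA κ Φ t p O.merged (KS.gT 0 gx κ Φ t p O.merged) (KS.fT 0 fx κ Φ t p O.merged) exA mx q ?_
    have h5 := hfloors.2.2.2.2.1
    have hm : (Nr + 1) * Skelφ.shearUnit (nL κ Φ t p O.merged (KS.gT 0 gx κ Φ t p O.merged) (KS.fT 0 fx κ Φ t p O.merged)) (hL κ Φ t p O.merged (KS.gT 0 gx κ Φ t p O.merged) (KS.fT 0 fx κ Φ t p O.merged)) ≤ 1000 * Neg.Kq κ * Skelφ.shearUnit (nL κ Φ t p O.merged (KS.gT 0 gx κ Φ t p O.merged) (KS.fT 0 fx κ Φ t p O.merged)) (hL κ Φ t p O.merged (KS.gT 0 gx κ Φ t p O.merged) (KS.fT 0 fx κ Φ t p O.merged)) :=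
      Nat.mul_le_mul_right _ (by omega)
    have h6 := hfloorsK
    omega
  have hπ1_of : ∀ {X : ℕ}, X ≤ Yb κ Φ t p O.merged (KS.gT 0 gx κ Φ t p O.merged) (KS.fT 0 fx κ Φ t p O.merged) → X ≤ Rπ κ Φ t p O.merged (KS.gT 0 gx κ Φ t p O.merged) (KS.fT 0 fx κ Φ t p O.merged) (SUA exA mx) q := by
    intro X hX
    refine ex_le_RπA κ Φ t p O.merged (KS.gT 0 gx κ Φ t p O.merged) (KS.fT 0 fx κ Φ t p O.merged) exA mx q ?_
    have h5 := hfloors.2.2.2.2.1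
    omega
  have hℓb27' : 2 * KS.bR κ Φ t p O.merged 0 + 27 ≤ KS.ℓBR κ Φ t p O.merged 0 := KS.ℓBR_ge κ Φ t p O.merged 0 _ hEb
  -- ### the three bridge cases
  rcases hφcase with hob | htr
  · -- #### case `o_b = o_L`: the bridge is the `σu` side half of `φL`
    have hφ : oriφ Φ.φ (O.ori t (KS.MBR κ Φ t p O.merged 0) (KS.nBR κ Φ t p O.merged 0)) = φL κ Φ t p O.D O.DT O.ori (KS.gT 0 gx κ Φ t p O.merged) (KS.fT 0 fx κ Φ t p O.merged) := by
      unfold NegB.φL; rw [hob]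
    have hΛ₁3 : |KS.Λ₁of κ Φ t p O.merged (KS.gT 0 gx κ Φ t p O.merged) (KS.fT 0 fx κ Φ t p O.merged) (KS.yYof κ Φ t p O.merged (KS.gT 0 gx κ Φ t p O.merged) (KS.fT 0 fx κ Φ t p O.merged) (KS.σuOf κ Φ t p O.merged (KS.gT 0 gx κ Φ t p O.merged) (KS.fT 0 fx κ Φ t p O.merged) (sgOf ((1 : Fin 2), sδ))) (sgOf ((1 : Fin 2), sδ)) (KS.yLs κ Φ t p O.merged (KS.gT 0 gx κ Φ t p O.merged) (KS.fT 0 fx κ Φ t p O.merged) 0 (KS.σuOf κ Φ t p O.merged (KS.gT 0 gx κ Φ t p O.merged) (KS.fT 0 fx κ Φ t p O.merged) (sgOf ((1 : Fin 2), sδ)))))| ≤ 3 * TwoAxis.Para.modulus (nL κ Φ t p O.merged (KS.gT 0 gx κ Φ t p O.merged) (KS.fT 0 fx κ Φ t p O.merged)) (hL κ Φ t p O.merged (KS.gT 0 gx κ Φ t p O.merged) (KS.fT 0 fx κ Φ t p O.merged)) (vL κ Φ t p O.merged (KS.gT 0 gx κ Φ t p O.merged) (KS.fT 0 fx κ Φ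 t p O.merged)) (Skelφ.NegPrm.vβOf (nL κ Φ t p O.merged (KS.gT 0 gx κ Φ t p O.merged) (KS.fT 0 fx κ Φ t p O.merged)) (hL κ Φ t p O.merged (KS.gT 0 gx κ Φ t p O.merged) (KS.fT 0 fx κ Φ t p O.merged)) (ℓL κ Φ t p O.merged (KS.gT 0 gx κ Φ t p O.merged) (KS.fT 0 fx κ Φ t p O.merged)) (vL κ Φ t p O.merged (KS.gT 0 gx κ Φ t p O.merged) (KS.fT 0 fx κ Φ t p O.merged))) := by
      have h1 := KS.abs_Λ₁of_yYof κ Φ t p O.merged (KS.gT 0 gx κ Φ t p O.merged) (KS.fT 0 fx κ Φ t p O.merged) hnL (KS.σuOf κ Φ t p O.merged (KS.gT 0 gx κ Φ t p O.merged) (KS.fT 0 fx κ Φ t p O.merged) (sgOf ((1 : Fin 2), sδ))) (sgOf ((1 : Fin 2), sδ)) (KS.yLs κ Φ t p O.merged (KS.gT 0 gx κ Φ t p O.merged) (KS.fT 0 fx κ Φ t p O.merged) 0 (KS.σuOf κ Φ t p O.merged (KS.gT 0 gx κ Φ t p O.merged) (KS.fT 0 fx κ Φ t p O.merged) (sgOf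 ((1 : Fin 2), sδ))))
      have h2 := hΛ3.1.2
      linarith
    have hNy := KS.NyOfA_spec κ Φ t p O.merged (KS.gT 0 gx κ Φ t p O.merged) (KS.fT 0 fx κ Φ t p O.merged) hN hσ (KS.yYof κ Φ t p O.merged (KS.gT 0 gx κ Φ t p O.merged) (KS.fT 0 fx κ Φ t p O.merged) (KS.σuOf κ Φ t p O.merged (KS.gT 0 gx κ Φ t p O.merged) (KS.fT 0 fx κ Φ t p O.merged) (sgOf ((1 : Fin 2), sδ))) (sgOf ((1 : Fin 2), sδ)) (KS.yLs κ Φ t p O.merged (KS.gT 0 gx κ Φ t p O.merged) (KS.fT 0 fx κ Φ t p O.merged) 0 (KS.σuOf κ Φ t p O.merged (KS.gT 0 gx κ Φ t p O.merged) (KS.fT 0 fx κ Φ t p O.merged) (sgOf ((1 : Fin 2), sδ))))) hΛ₁3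
    have hNy' : (KS.NyOfA κ Φ t p O.merged (KS.gT 0 gx κ Φ t p O.merged) (KS.fT 0 fx κ Φ t p O.merged) (sgOf ((1 : Fin 2), sδ)) (KS.yYof κ Φ t p O.merged (KS.gT 0 gx κ Φ t p O.merged) (KS.fT 0 fx κ Φ t p O.merged) (KS.σuOf κ Φ t p O.merged (KS.gT 0 gx κ Φ t p O.merged) (KS.fT 0 fx κ Φ t p O.merged) (sgOf ((1 : Fin 2), sδ))) (sgOf ((1 : Fin 2), sδ)) (KS.yLs κ Φ t p O.merged (KS.gT 0 gx κ Φ t p O.merged) (KS.fT 0 fx κ Φ t p O.merged) 0 (KS.σuOf κ Φ t p O.merged (KS.gT 0 gx κ Φ t p O.merged) (KS.fT 0 fx κ Φ t p O.merged) (sgOf ((1 : Fin 2), sδ)))))) + 1 ≤ 1000 * Neg.Kq κ := by have := hNy.1; omega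
    have hρ := KS.ρY_bounds κ Φ t p O.merged (KS.gT 0 gx κ Φ t p O.merged) (KS.fT 0 fx κ Φ t p O.merged) hnL (KS.σuOf κ Φ t p O.merged (KS.gT 0 gx κ Φ t p O.merged) (KS.fT 0 fx κ Φ t p O.merged) (sgOf ((1 : Fin 2), sδ))) (sgOf ((1 : Fin 2), sδ))
    have hrel := KS.Λ₀of_yYof κ Φ t p O.merged (KS.gT 0 gx κ Φ t p O.merged) (KS.fT 0 fx κ Φ t p O.merged) (KS.σuOf κ Φ t p O.merged (KS.gT 0 gx κ Φ t p O.merged) (KS.fT 0 fx κ Φ t p O.merged) (sgOf ((1 : Fin 2), sδ))) (sgOf ((1 : Fin 2), sδ)) (KS.yLs κ Φ t p O.merged (KS.gT 0 gx κ Φ t p O.merged) (KS.fT 0 fx κ Φ t p O.merged) 0 (KS.σuOf κ Φ t p O.merged (KS.gT 0 gx κ Φ t p O.merged) (KS.fT 0 fx κ Φ t p O.merged) (sgOf ((1 : Fin 2), sδ))))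
    have hyY := le_trans (KS.yYof_l1 κ Φ t p O.merged (KS.gT 0 gx κ Φ t p O.merged) (KS.fT 0 fx κ Φ t p O.merged) hnL hv hκ hσu hσ (KS.yLs κ Φ t p O.merged (KS.gT 0 gx κ Φ t p O.merged) (KS.fT 0 fx κ Φ t p O.merged) 0 (KS.σuOf κ Φ t p O.merged (KS.gT 0 gx κ Φ t p O.merged) (KS.fT 0 fx κ Φ t p O.merged) (sgOf ((1 : Fin 2), sδ))))) (Nat.add_le_add_right hyl.1 _)
    have hclr := KS.hclr_s κ Φ t p O.merged (KS.gT 0 gx κ Φ t p O.merged) (KS.fT 0 fx κ Φ t p O.merged) 0 hσu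
    have hx0 : (O.merged.k : ℤ) < (KS.σuOf κ Φ t p O.merged (KS.gT 0 gx κ Φ t p O.merged) (KS.fT 0 fx κ Φ t p O.merged) (sgOf ((1 : Fin 2), sδ))) * (KS.yLs κ Φ t p O.merged (KS.gT 0 gx κ Φ t p O.merged) (KS.fT 0 fx κ Φ t p O.merged) 0 (KS.σuOf κ Φ t p O.merged (KS.gT 0 gx κ Φ t p O.merged) (KS.fT 0 fx κ Φ t p O.merged) (sgOf ((1 : Fin 2), sδ)))) 0 + ((nL κ Φ t p O.merged (KS.gT 0 gx κ Φ t p O.merged) (KS.fT 0 fx κ Φ t p O.merged) : ℕ) : ℤ) := by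
      have h := hclr
      have h1 := Int.natCast_nonneg (KS.qBs κ Φ t p O.merged 0)
      have h2 := Int.natCast_nonneg (KS.RA' κ Φ t p O.merged 0)
      have h3 := Int.natCast_nonneg (nL κ Φ t p O.merged (KS.gT 0 gx κ Φ t p O.merged) (KS.fT 0 fx κ Φ t p O.merged))
      linarith
    obtain ⟨hQb, hFb, hFZ, hbridge⟩ := Skelφ.bridgeData_same t hσu (nL κ Φ t p O.merged (KS.gT 0 gx κ Φ t p O.merged) (KS.fT 0 fx κ Φ t p O.merged)) (hL κ Φ t p O.merged (KS.gT 0 gx κ Φ t p O.merged) (KS.fT 0 fx κ Φ t p O.merged)) (ℓL κ Φ t p O.merged (KS.gT 0 gx κ Φ t p O.merged) (KS.fT 0 fx κ Φ t p O.merged)) (KS.RA' κ Φ t p O.merged 0)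
      hnb (KS.hBR κ Φ t p O.merged 0) (KS.ℓBR κ Φ t p O.merged 0) (Rb κ Φ t p O.merged) (KS.vBR κ Φ t p O.merged 0) hZ (hservedB hNy.1) hMzb hφ
    exact rootOblTWAt_negBTA_y hAt h1 hp0 hp1 ((1 : Fin 2), sδ) hσu 0 3 (KS.qBs κ Φ t p O.merged 0) (KS.NyOfA κ Φ t p O.merged (KS.gT 0 gx κ Φ t p O.merged) (KS.fT 0 fx κ Φ t p O.merged) (sgOf ((1 : Fin 2), sδ)) (KS.yYof κ Φ t p O.merged (KS.gT 0 gx κ Φ t p O.merged) (KS.fT 0 fx κ Φ t p O.merged) (KS.σuOf κ Φ t p O.merged (KS.gT 0 gx κ Φ t p O.merged) (KS.fT 0 fx κ Φ t p O.merged) (sgOf ((1 : Fin 2), sδ))) (sgOf ((1 : Fin 2), sδ)) (KS.yLs κ Φ t p O.merged (KS.gT 0 gx κ Φ t p O.merged) (KS.fT 0 fx κ Φ t p O.merged) 0 (KS.σuOf κ Φ t p O.merged (KS.gT 0 gx κ Φ t p O.merged) (KS.fT 0 fx κ Φ t p O.merged) (sgOf ((1 : Fin 2), sδ)))))) (KS.qY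 κ Φ t p O.merged (KS.gT 0 gx κ Φ t p O.merged) (KS.fT 0 fx κ Φ t p O.merged) 0) _ (Rb κ Φ t p O.merged) (hLf hNy.1) hflat
      (KS.yLs κ Φ t p O.merged (KS.gT 0 gx κ Φ t p O.merged) (KS.fT 0 fx κ Φ t p O.merged) 0 (KS.σuOf κ Φ t p O.merged (KS.gT 0 gx κ Φ t p O.merged) (KS.fT 0 fx κ Φ t p O.merged) (sgOf ((1 : Fin 2), sδ)))) (KS.yYof κ Φ t p O.merged (KS.gT 0 gx κ Φ t p O.merged) (KS.fT 0 fx κ Φ t p O.merged) (KS.σuOf κ Φ t p O.merged (KS.gT 0 gx κ Φ t p O.merged) (KS.fT 0 fx κ Φ t p O.merged) (sgOf ((1 : Fin 2), sδ))) (sgOf ((1 : Fin 2), sδ)) (KS.yLs κ Φ t p O.merged (KS.gT 0 gx κ Φ t p O.merged) (KS.fT 0 fx κ Φ t p O.merged) 0 (KS.σuOf κ Φ t p O.merged (KS.gT 0 gx κ Φ t p O.merged) (KS.fT 0 fx κ Φ t p O.merged) (sgOf ((1 : Fin 2), sδ))))) (mx κ Φ t p O.merged (KS.gT 0 gx κ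 Φ t p O.merged) (KS.fT 0 fx κ Φ t p O.merged))
      (KS.kit_mem_PR κ Φ t p O.merged 0 Px) hRQ hRB hRQ' hRM hΛRg hkA0 hkA1 ⟨hkAQ' 1, hkAQ' 0⟩ hρπ _ hbOK.1 le_rfl _ _ hQb hFb hFZ hbridge
      hB0 hRlπ hΛR hΛQ.1 hΛQ.2 hkR0 hkR1 (fun h => absurd h.symm Fin.zero_ne_one) (fun _ => hfR.2)
      (KS.hprism_R κ Φ t p O.merged (KS.gT 0 gx κ Φ t p O.merged) (KS.fT 0 fx κ Φ t p O.merged) 0 _ _)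
      (Skelφ.pt_zero _ _).le (Skelφ.pt_zero _ _).ge (Skelφ.pt_one _ _).le (Skelφ.pt_one _ _).ge
      (KS.hPfX₁σ_RA κ Φ t p O.merged 0 gx fx hN hκ (KS.yLs κ Φ t p O.merged (KS.gT 0 gx κ Φ t p O.merged) (KS.fT 0 fx κ Φ t p O.merged) 0 (KS.σuOf κ Φ t p O.merged (KS.gT 0 gx κ Φ t p O.merged) (KS.fT 0 fx κ Φ t p O.merged) (sgOf ((1 : Fin 2), sδ)))) (KS.qBs κ Φ t p O.merged 0) hq4s hnA hMA hσu hΛ3.1.2 (sgOf ((1 : Fin 2), sδ))) (KS.hPfX₂σ_RA κ Φ t p O.merged 0 gx fx hN hκ (KS.yLs κ Φ t p O.merged (KS.gT 0 gx κ Φ t p O.merged) (KS.fT 0 fx κ Φ t p O.merged) 0 (KS.σuOf κ Φ t p O.merged (KS.gT 0 gx κ Φ t p O.merged) (KS.fT 0 fx κ Φ t p O.merged) (sgOf ((1 : Fin 2), sδ)))) (KS.qBs κ Φ t p O.merged 0) hq4s hnA hMA hσu hΛ3.1.2 (sgOf ((1 : Fin 2), sδ)))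
      (KS.hPfX₃_RA κ Φ t p O.merged 0 gx fx hN hκ (KS.yLs κ Φ t p O.merged (KS.gT 0 gx κ Φ t p O.merged) (KS.fT 0 fx κ Φ t p O.merged) 0 (KS.σuOf κ Φ t p O.merged (KS.gT 0 gx κ Φ t p O.merged) (KS.fT 0 fx κ Φ t p O.merged) (sgOf ((1 : Fin 2), sδ)))) (KS.qBs κ Φ t p O.merged 0) hq4s hnA hMA hσu hΛ3.1.1)
      (KS.hregY_R κ Φ t p O.merged (KS.gT 0 gx κ Φ t p O.merged) (KS.fT 0 fx κ Φ t p O.merged) 0 hnL hv hlay _ _) (KS.hlastcY_R κ Φ t p O.merged (KS.gT 0 gx κ Φ t p O.merged) (KS.fT 0 fx κ Φ t p O.merged) 0 hnL hv hlay _ _)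
      (fun _ _ => (Skelφ.pt_zero _ _).le) (fun _ _ => (Skelφ.pt_zero _ _).ge) (fun _ _ => (Skelφ.pt_one _ _).le) (fun _ _ => (Skelφ.pt_one _ _).ge)
      (fun k hk => ((KS.hQfY_lev_RA κ Φ t p O.merged 0 gx fx hN hκ hnA hMA hσ (KS.yYof κ Φ t p O.merged (KS.gT 0 gx κ Φ t p O.merged) (KS.fT 0 fx κ Φ t p O.merged) (KS.σuOf κ Φ t p O.merged (KS.gT 0 gx κ Φ t p O.merged) (KS.fT 0 fx κ Φ t p O.merged) (sgOf ((1 : Fin 2), sδ))) (sgOf ((1 : Fin 2), sδ)) (KS.yLs κ Φ t p O.merged (KS.gT 0 gx κ Φ t p O.merged) (KS.fT 0 fx κ Φ t p O.merged) 0 (KS.σuOf κ Φ t p O.merged (KS.gT 0 gx κ Φ t p O.merged) (KS.fT 0 fx κ Φ t p O.merged) (sgOf ((1 : Fin 2), sδ))))) hΛ₁3) k hk).1) (fun k hk => ((KS.hQfY_lev_RA κ Φ t p O.merged 0 gx fx hN hκ hnA hMA hσ (KS.yYof κ Φ t p O.merged (KS.gT 0 gx κ Φ t p O.merged) (KS.fT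 0 fx κ Φ t p O.merged) (KS.σuOf κ Φ t p O.merged (KS.gT 0 gx κ Φ t p O.merged) (KS.fT 0 fx κ Φ t p O.merged) (sgOf ((1 : Fin 2), sδ))) (sgOf ((1 : Fin 2), sδ)) (KS.yLs κ Φ t p O.merged (KS.gT 0 gx κ Φ t p O.merged) (KS.fT 0 fx κ Φ t p O.merged) 0 (KS.σuOf κ Φ t p O.merged (KS.gT 0 gx κ Φ t p O.merged) (KS.fT 0 fx κ Φ t p O.merged) (sgOf ((1 : Fin 2), sδ))))) hΛ₁3) k hk).2)
      (KS.hQfY₃_RA κ Φ t p O.merged 0 gx fx hN hκ hnA hMA hσu hσ (KS.yLs κ Φ t p O.merged (KS.gT 0 gx κ Φ t p O.merged) (KS.fT 0 fx κ Φ t p O.merged) 0 (KS.σuOf κ Φ t p O.merged (KS.gT 0 gx κ Φ t p O.merged) (KS.fT 0 fx κ Φ t p O.merged) (sgOf ((1 : Fin 2), sδ)))) (KS.yYof κ Φ t p O.merged (KS.gT 0 gx κ Φ t p O.merged) (KS.fT 0 fx κ Φ t p O.merged) (KS.σuOf κ Φ t p O.merged (KS.gT 0 gx κ Φ t p O.merged)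 (KS.fT 0 fx κ Φ t p O.merged) (sgOf ((1 : Fin 2), sδ))) (sgOf ((1 : Fin 2), sδ)) (KS.yLs κ Φ t p O.merged (KS.gT 0 gx κ Φ t p O.merged) (KS.fT 0 fx κ Φ t p O.merged) 0 (KS.σuOf κ Φ t p O.merged (KS.gT 0 gx κ Φ t p O.merged) (KS.fT 0 fx κ Φ t p O.merged) (sgOf ((1 : Fin 2), sδ))))) hΛ₁3 hρ.1 hρ.2 hrel hΛ7.1)
      (Skelφ.pt_zero _ _).le (Skelφ.pt_zero _ _).ge (Skelφ.pt_one _ _).le (Skelφ.pt_one _ _).ge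
      (fun h => KS.hLgY₁_RA κ Φ t p O.merged 0 gx fx hN hκ hnA hMA hσ (KS.yYof κ Φ t p O.merged (KS.gT 0 gx κ Φ t p O.merged) (KS.fT 0 fx κ Φ t p O.merged) (KS.σuOf κ Φ t p O.merged (KS.gT 0 gx κ Φ t p O.merged) (KS.fT 0 fx κ Φ t p O.merged) (sgOf ((1 : Fin 2), sδ))) (sgOf ((1 : Fin 2), sδ)) (KS.yLs κ Φ t p O.merged (KS.gT 0 gx κ Φ t p O.merged) (KS.fT 0 fx κ Φ t p O.merged) 0 (KS.σuOf κ Φ t p O.merged (KS.gT 0 gx κ Φ t p O.merged) (KS.fT 0 fx κ Φ t p O.merged) (sgOf ((1 : Fin 2), sδ))))) hΛ₁3 h) (fun h => KS.hLgY₂_RA κ Φ t p O.merged 0 gx fx hN hκ hnA hMA hσ (KS.yYof κ Φ t p O.merged (KS.gT 0 gx κ Φ t p O.merged) (KS.fT 0 fx κ Φ t p O.merged) (KS.σuOf κ Φ t p O.merged (KS.gT 0 gx κ Φ t p O.merged) (KS.fT 0 fx κ Φ t p O.merged) (sgOf ((1 : Fin 2), sδ))) (sgOf ((1 : Fin 2),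 sδ)) (KS.yLs κ Φ t p O.merged (KS.gT 0 gx κ Φ t p O.merged) (KS.fT 0 fx κ Φ t p O.merged) 0 (KS.σuOf κ Φ t p O.merged (KS.gT 0 gx κ Φ t p O.merged) (KS.fT 0 fx κ Φ t p O.merged) (sgOf ((1 : Fin 2), sδ))))) hΛ₁3 h)
      (KS.hLgY₃_RA κ Φ t p O.merged 0 gx fx hN hκ hnA hMA hσu hσ (KS.yLs κ Φ t p O.merged (KS.gT 0 gx κ Φ t p O.merged) (KS.fT 0 fx κ Φ t p O.merged) 0 (KS.σuOf κ Φ t p O.merged (KS.gT 0 gx κ Φ t p O.merged) (KS.fT 0 fx κ Φ t p O.merged) (sgOf ((1 : Fin 2), sδ)))) (KS.yYof κ Φ t p O.merged (KS.gT 0 gx κ Φ t p O.merged) (KS.fT 0 fx κ Φ t p O.merged) (KS.σuOf κ Φ t p O.merged (KS.gT 0 gx κ Φ t p O.merged) (KS.fT 0 fx κ Φ t p O.merged) (sgOf ((1 : Fin 2), sδ))) (sgOf ((1 : Fin 2), sδ)) (KS.yLs κ Φ t p O.merged (KS.gT 0 gx κ Φ t p O.merged) (KS.fT 0 fx κ Φ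 t p O.merged) 0 (KS.σuOf κ Φ t p O.merged (KS.gT 0 gx κ Φ t p O.merged) (KS.fT 0 fx κ Φ t p O.merged) (sgOf ((1 : Fin 2), sδ))))) hΛ₁3 hρ.1 hρ.2 hrel hΛ7.1)
      (KS.hxa_s κ Φ t p O.merged (KS.gT 0 gx κ Φ t p O.merged) (KS.fT 0 fx κ Φ t p O.merged) 0 hσu) (KS.hxb_s κ Φ t p O.merged 0 gx fx hN hκ hσu) hclr hRn hclr₁
      (hπ1_of hc1.1) (hπ_of hyl.1 (by have := Neg.one_le_Kq κ; omega))
      (KS.hclrY_RA κ Φ t p O.merged (KS.gT 0 gx κ Φ t p O.merged) (KS.fT 0 fx κ Φ t p O.merged) 0 hv hnA hσu hσ hs (KS.yLs κ Φ t p O.merged (KS.gT 0 gx κ Φ t p O.merged) (KS.fT 0 fx κ Φ t p O.merged) 0 (KS.σuOf κ Φ t p O.merged (KS.gT 0 gx κ Φ t p O.merged) (KS.fT 0 fx κ Φ t p O.merged) (sgOf ((1 : Fin 2), sδ)))) hx0 _ _ hNy')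
      (KS.hx₂₃_R κ Φ t p O.merged (KS.gT 0 gx κ Φ t p O.merged) (KS.fT 0 fx κ Φ t p O.merged) 0 hnL hv hlay hRAn hσu hσ (KS.yLs κ Φ t p O.merged (KS.gT 0 gx κ Φ t p O.merged) (KS.fT 0 fx κ Φ t p O.merged) 0 (KS.σuOf κ Φ t p O.merged (KS.gT 0 gx κ Φ t p O.merged) (KS.fT 0 fx κ Φ t p O.merged) (sgOf ((1 : Fin 2), sδ)))) (KS.qBs κ Φ t p O.merged 0) hq4s _)
      (fun k hk => le_trans (KS.hπ3_RA κ Φ t p O.merged (KS.gT 0 gx κ Φ t p O.merged) (KS.fT 0 fx κ Φ t p O.merged) 0 hnL hv hκ hlay (KS.yYof κ Φ t p O.merged (KS.gT 0 gx κ Φ t p O.merged) (KS.fT 0 fx κ Φ t p O.merged) (KS.σuOf κ Φ t p O.merged (KS.gT 0 gx κ Φ t p O.merged) (KS.fT 0 fx κ Φ t p O.merged) (sgOf ((1 : Fin 2), sδ))) (sgOf ((1 : Fin 2), sδ)) (KS.yLs κ Φ t p O.merged (KS.gT 0 gx κ Φ t p O.merged) (KS.fT 0 fx κ Φ t p O.merged)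 0 (KS.σuOf κ Φ t p O.merged (KS.gT 0 gx κ Φ t p O.merged) (KS.fT 0 fx κ Φ t p O.merged) (sgOf ((1 : Fin 2), sδ))))) hyY _ _ hNy' k hk) hexRπ)
      hclrz hRb₀ hRr₀ hRbπ hR₁b hR₁r
  · rcases Nat.lt_or_ge (KS.ℓBR κ Φ t p O.merged 0) (2 * (KS.hBR κ Φ t p O.merged 0).natAbs) with hside | htop
    · -- #### case `o_b ≠ o_L`, steep: the bridge is a side half of `trφ φL`
      have hΛ₁3 : |KS.Λ₁of κ Φ t p O.merged (KS.gT 0 gx κ Φ t p O.merged) (KS.fT 0 fx κ Φ t p O.merged) (KS.yYof κ Φ t p O.merged (KS.gT 0 gx κ Φ t p O.merged) (KS.fT 0 fx κ Φ t p O.merged) (KS.σuOf κ Φ t p O.merged (KS.gT 0 gx κ Φ t p O.merged) (KS.fT 0 fx κ Φ t p O.merged) (sgOf ((1 : Fin 2), sδ))) (sgOf ((1 : Fin 2), sδ)) (KS.yLd κ Φ t p O.merged (KS.gT 0 gx κ Φ t p O.merged) (KS.fT 0 fx κ Φ t p O.merged) 0 (KS.σuOf κ Φ t p O.merged (KS.gT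 0 gx κ Φ t p O.merged) (KS.fT 0 fx κ Φ t p O.merged) (sgOf ((1 : Fin 2), sδ)))))| ≤ 3 * TwoAxis.Para.modulus (nL κ Φ t p O.merged (KS.gT 0 gx κ Φ t p O.merged) (KS.fT 0 fx κ Φ t p O.merged)) (hL κ Φ t p O.merged (KS.gT 0 gx κ Φ t p O.merged) (KS.fT 0 fx κ Φ t p O.merged)) (vL κ Φ t p O.merged (KS.gT 0 gx κ Φ t p O.merged) (KS.fT 0 fx κ Φ t p O.merged)) (Skelφ.NegPrm.vβOf (nL κ Φ t p O.merged (KS.gT 0 gx κ Φ t p O.merged) (KS.fT 0 fx κ Φ t p O.merged)) (hL κ Φ t p O.merged (KS.gT 0 gx κ Φ t p O.merged) (KS.fT 0 fx κ Φ t p O.merged)) (ℓL κ Φ t p O.merged (KS.gT 0 gx κ Φ t p O.merged) (KS.fT 0 fx κ Φ t p O.merged)) (vL κ Φ t p O.merged (KS.gT 0 gx κ Φ t p O.merged) (KS.fT 0 fx κ Φ t p O.merged))) := by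
        have h1 := KS.abs_Λ₁of_yYof κ Φ t p O.merged (KS.gT 0 gx κ Φ t p O.merged) (KS.fT 0 fx κ Φ t p O.merged) hnL (KS.σuOf κ Φ t p O.merged (KS.gT 0 gx κ Φ t p O.merged) (KS.fT 0 fx κ Φ t p O.merged) (sgOf ((1 : Fin 2), sδ))) (sgOf ((1 : Fin 2), sδ)) (KS.yLd κ Φ t p O.merged (KS.gT 0 gx κ Φ t p O.merged) (KS.fT 0 fx κ Φ t p O.merged) 0 (KS.σuOf κ Φ t p O.merged (KS.gT 0 gx κ Φ t p O.merged) (KS.fT 0 fx κ Φ t p O.merged) (sgOf ((1 : Fin 2), sδ))))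
        have h2 := hΛ3.2.1.2
        linarith
      have hNy := KS.NyOfA_spec κ Φ t p O.merged (KS.gT 0 gx κ Φ t p O.merged) (KS.fT 0 fx κ Φ t p O.merged) hN hσ (KS.yYof κ Φ t p O.merged (KS.gT 0 gx κ Φ t p O.merged) (KS.fT 0 fx κ Φ t p O.merged) (KS.σuOf κ Φ t p O.merged (KS.gT 0 gx κ Φ t p O.merged) (KS.fT 0 fx κ Φ t p O.merged) (sgOf ((1 : Fin 2), sδ))) (sgOf ((1 : Fin 2), sδ)) (KS.yLd κ Φ t p O.merged (KS.gT 0 gx κ Φ t p O.merged) (KS.fT 0 fx κ Φ t p O.merged) 0 (KS.σuOf κ Φ t p O.merged (KS.gT 0 gx κ Φ t p O.merged) (KS.fT 0 fx κ Φ t p O.merged) (sgOf ((1 : Fin 2), sδ))))) hΛ₁3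
      have hNy' : (KS.NyOfA κ Φ t p O.merged (KS.gT 0 gx κ Φ t p O.merged) (KS.fT 0 fx κ Φ t p O.merged) (sgOf ((1 : Fin 2), sδ)) (KS.yYof κ Φ t p O.merged (KS.gT 0 gx κ Φ t p O.merged) (KS.fT 0 fx κ Φ t p O.merged) (KS.σuOf κ Φ t p O.merged (KS.gT 0 gx κ Φ t p O.merged) (KS.fT 0 fx κ Φ t p O.merged) (sgOf ((1 : Fin 2), sδ))) (sgOf ((1 : Fin 2), sδ)) (KS.yLd κ Φ t p O.merged (KS.gT 0 gx κ Φ t p O.merged) (KS.fT 0 fx κ Φ t p O.merged) 0 (KS.σuOf κ Φ t p O.merged (KS.gT 0 gx κ Φ t p O.merged) (KS.fT 0 fx κ Φ t p O.merged) (sgOf ((1 : Fin 2), sδ)))))) + 1 ≤ 1000 * Neg.Kq κ := by have := hNy.1; omega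
      have hρ := KS.ρY_bounds κ Φ t p O.merged (KS.gT 0 gx κ Φ t p O.merged) (KS.fT 0 fx κ Φ t p O.merged) hnL (KS.σuOf κ Φ t p O.merged (KS.gT 0 gx κ Φ t p O.merged) (KS.fT 0 fx κ Φ t p O.merged) (sgOf ((1 : Fin 2), sδ))) (sgOf ((1 : Fin 2), sδ))
      have hrel := KS.Λ₀of_yYof κ Φ t p O.merged (KS.gT 0 gx κ Φ t p O.merged) (KS.fT 0 fx κ Φ t p O.merged) (KS.σuOf κ Φ t p O.merged (KS.gT 0 gx κ Φ t p O.merged) (KS.fT 0 fx κ Φ t p O.merged) (sgOf ((1 : Fin 2), sδ))) (sgOf ((1 : Fin 2), sδ)) (KS.yLd κ Φ t p O.merged (KS.gT 0 gx κ Φ t p O.merged) (KS.fT 0 fx κ Φ t p O.merged) 0 (KS.σuOf κ Φ t p O.merged (KS.gT 0 gx κ Φ t p O.merged) (KS.fT 0 fx κ Φ t p O.merged) (sgOf ((1 : Fin 2), sδ))))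
      have hyY := le_trans (KS.yYof_l1 κ Φ t p O.merged (KS.gT 0 gx κ Φ t p O.merged) (KS.fT 0 fx κ Φ t p O.merged) hnL hv hκ hσu hσ (KS.yLd κ Φ t p O.merged (KS.gT 0 gx κ Φ t p O.merged) (KS.fT 0 fx κ Φ t p O.merged) 0 (KS.σuOf κ Φ t p O.merged (KS.gT 0 gx κ Φ t p O.merged) (KS.fT 0 fx κ Φ t p O.merged) (sgOf ((1 : Fin 2), sδ))))) (Nat.add_le_add_right hyl.2.1 _)
      have hclr := KS.hclr_d κ Φ t p O.merged (KS.gT 0 gx κ Φ t p O.merged) (KS.fT 0 fx κ Φ t p O.merged) 0 hσu hside hℓb27'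
      have hx0 : (O.merged.k : ℤ) < (KS.σuOf κ Φ t p O.merged (KS.gT 0 gx κ Φ t p O.merged) (KS.fT 0 fx κ Φ t p O.merged) (sgOf ((1 : Fin 2), sδ))) * (KS.yLd κ Φ t p O.merged (KS.gT 0 gx κ Φ t p O.merged) (KS.fT 0 fx κ Φ t p O.merged) 0 (KS.σuOf κ Φ t p O.merged (KS.gT 0 gx κ Φ t p O.merged) (KS.fT 0 fx κ Φ t p O.merged) (sgOf ((1 : Fin 2), sδ)))) 0 + ((nL κ Φ t p O.merged (KS.gT 0 gx κ Φ t p O.merged) (KS.fT 0 fx κ Φ t p O.merged) : ℕ) : ℤ) := by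
        have h := hclr
        have h1 := Int.natCast_nonneg (KS.qBd κ Φ t p O.merged 0)
        have h2 := Int.natCast_nonneg (KS.RA' κ Φ t p O.merged 0)
        have h3 := Int.natCast_nonneg (nL κ Φ t p O.merged (KS.gT 0 gx κ Φ t p O.merged) (KS.fT 0 fx κ Φ t p O.merged))
        linarith
      obtain ⟨hQb, hFb, hFZ, hbridge⟩ := Skelφ.bridgeData_trSide t hσu (nL κ Φ t p O.merged (KS.gT 0 gx κ Φ t p O.merged) (KS.fT 0 fx κ Φ t p O.merged)) (hL κ Φ t p O.merged (KS.gT 0 gx κ Φ t p O.merged) (KS.fT 0 fx κ Φ t p O.merged)) (ℓL κ Φ t p O.merged (KS.gT 0 gx κ Φ t p O.merged) (KS.fT 0 fx κ Φ t p O.merged)) (KS.RA' κ Φ t p O.merged 0)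
        hnb (KS.hBR κ Φ t p O.merged 0) (KS.ℓBR κ Φ t p O.merged 0) (Rb κ Φ t p O.merged) (KS.vBR κ Φ t p O.merged 0) hZ (hservedB hNy.1) hMzb htr
      exact rootOblTWAt_negBTA_y hAt h1 hp0 hp1 ((1 : Fin 2), sδ) hσu 0 3 (KS.qBd κ Φ t p O.merged 0) (KS.NyOfA κ Φ t p O.merged (KS.gT 0 gx κ Φ t p O.merged) (KS.fT 0 fx κ Φ t p O.merged) (sgOf ((1 : Fin 2), sδ)) (KS.yYof κ Φ t p O.merged (KS.gT 0 gx κ Φ t p O.merged) (KS.fT 0 fx κ Φ t p O.merged) (KS.σuOf κ Φ t p O.merged (KS.gT 0 gx κ Φ t p O.merged) (KS.fT 0 fx κ Φ t p O.merged) (sgOf ((1 : Fin 2), sδ))) (sgOf ((1 : Fin 2), sδ)) (KS.yLd κ Φ t p O.merged (KS.gT 0 gx κ Φ t p O.merged) (KS.fT 0 fx κ Φ t p O.merged) 0 (KS.σuOf κ Φ t p O.merged (KS.gT 0 gx κ Φ t p O.merged) (KS.fT 0 fx κ Φ t p O.merged) (sgOf ((1 : Fin 2), sδ)))))) (KS.qY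 κ Φ t p O.merged (KS.gT 0 gx κ Φ t p O.merged) (KS.fT 0 fx κ Φ t p O.merged) 0) _ (Rb κ Φ t p O.merged) (hLf hNy.1) hflat
        (KS.yLd κ Φ t p O.merged (KS.gT 0 gx κ Φ t p O.merged) (KS.fT 0 fx κ Φ t p O.merged) 0 (KS.σuOf κ Φ t p O.merged (KS.gT 0 gx κ Φ t p O.merged) (KS.fT 0 fx κ Φ t p O.merged) (sgOf ((1 : Fin 2), sδ)))) (KS.yYof κ Φ t p O.merged (KS.gT 0 gx κ Φ t p O.merged) (KS.fT 0 fx κ Φ t p O.merged) (KS.σuOf κ Φ t p O.merged (KS.gT 0 gx κ Φ t p O.merged) (KS.fT 0 fx κ Φ t p O.merged) (sgOf ((1 : Fin 2), sδ))) (sgOf ((1 : Fin 2), sδ)) (KS.yLd κ Φ t p O.merged (KS.gT 0 gx κ Φ t p O.merged) (KS.fT 0 fx κ Φ t p O.merged) 0 (KS.σuOf κ Φ t p O.merged (KS.gT 0 gx κ Φ t p O.merged) (KS.fT 0 fx κ Φ t p O.merged) (sgOf ((1 : Fin 2), sδ))))) (mx κ Φ t p O.merged (KS.gT 0 gx κ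 Φ t p O.merged) (KS.fT 0 fx κ Φ t p O.merged))
        (KS.kit_mem_PR κ Φ t p O.merged 0 Px) hRQ hRB hRQ' hRM hΛRg hkA0 hkA1 ⟨hkAQ' 1, hkAQ' 0⟩ hρπ _ hbOK.2.1 (le_of_eq hfrB.2.2.2.2.1.symm) _ _ hQb hFb hFZ hbridge
        (by rw [hfrB.1, hfrB.2.1]; exact hB0) hRlπ (by rw [hregB.1, hregB.2.1]; exact hΛR) hΛQ.1 hΛQ.2 hkR0 hkR1 (fun h => absurd h.symm Fin.zero_ne_one) (fun _ => hfR.2)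
        (KS.hprism_R κ Φ t p O.merged (KS.gT 0 gx κ Φ t p O.merged) (KS.fT 0 fx κ Φ t p O.merged) 0 _ _)
        (Skelφ.pt_zero _ _).le (Skelφ.pt_zero _ _).ge (Skelφ.pt_one _ _).le (Skelφ.pt_one _ _).ge
        (KS.hPfX₁σ_RA κ Φ t p O.merged 0 gx fx hN hκ (KS.yLd κ Φ t p O.merged (KS.gT 0 gx κ Φ t p O.merged) (KS.fT 0 fx κ Φ t p O.merged) 0 (KS.σuOf κ Φ t p O.merged (KS.gT 0 gx κ Φ t p O.merged) (KS.fT 0 fx κ Φ t p O.merged) (sgOf ((1 : Fin 2), sδ)))) (KS.qBd κ Φ t p O.merged 0) hq4dt.1 hnA hMA hσu hΛ3.2.1.2 (sgOf ((1 : Fin 2), sδ))) (KS.hPfX₂σ_RA κ Φ t p O.merged 0 gx fx hN hκ (KS.yLd κ Φ t p O.merged (KS.gT 0 gx κ Φ t p O.merged) (KS.fT 0 fx κ Φ t p O.merged) 0 (KS.σuOf κ Φ t p O.merged (KS.gT 0 gx κ Φ t p O.merged) (KS.fT 0 fx κ Φ t p O.merged) (sgOf ((1 : Fin 2), sδ))))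 (KS.qBd κ Φ t p O.merged 0) hq4dt.1 hnA hMA hσu hΛ3.2.1.2 (sgOf ((1 : Fin 2), sδ)))
        (KS.hPfX₃_RA κ Φ t p O.merged 0 gx fx hN hκ (KS.yLd κ Φ t p O.merged (KS.gT 0 gx κ Φ t p O.merged) (KS.fT 0 fx κ Φ t p O.merged) 0 (KS.σuOf κ Φ t p O.merged (KS.gT 0 gx κ Φ t p O.merged) (KS.fT 0 fx κ Φ t p O.merged) (sgOf ((1 : Fin 2), sδ)))) (KS.qBd κ Φ t p O.merged 0) hq4dt.1 hnA hMA hσu hΛ3.2.1.1)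
        (KS.hregY_R κ Φ t p O.merged (KS.gT 0 gx κ Φ t p O.merged) (KS.fT 0 fx κ Φ t p O.merged) 0 hnL hv hlay _ _) (KS.hlastcY_R κ Φ t p O.merged (KS.gT 0 gx κ Φ t p O.merged) (KS.fT 0 fx κ Φ t p O.merged) 0 hnL hv hlay _ _)
        (fun _ _ => (Skelφ.pt_zero _ _).le) (fun _ _ => (Skelφ.pt_zero _ _).ge) (fun _ _ => (Skelφ.pt_one _ _).le) (fun _ _ => (Skelφ.pt_one _ _).ge)
        (fun k hk => ((KS.hQfY_lev_RA κ Φ t p O.merged 0 gx fx hN hκ hnA hMA hσ (KS.yYof κ Φ t p O.merged (KS.gT 0 gx κ Φ t p O.merged) (KS.fT 0 fx κ Φ t p O.merged) (KS.σuOf κ Φ t p O.merged (KS.gT 0 gx κ Φ t p O.merged) (KS.fT 0 fx κ Φ t p O.merged) (sgOf ((1 : Fin 2), sδ))) (sgOf ((1 : Fin 2), sδ)) (KS.yLd κ Φ t p O.merged (KS.gT 0 gx κ Φ t p O.merged) (KS.fT 0 fx κ Φ t p O.merged) 0 (KS.σuOf κ Φ t p O.merged (KS.gT 0 gx κ Φ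 t p O.merged) (KS.fT 0 fx κ Φ t p O.merged) (sgOf ((1 : Fin 2), sδ))))) hΛ₁3) k hk).1) (fun k hk => ((KS.hQfY_lev_RA κ Φ t p O.merged 0 gx fx hN hκ hnA hMA hσ (KS.yYof κ Φ t p O.merged (KS.gT 0 gx κ Φ t p O.merged) (KS.fT 0 fx κ Φ t p O.merged) (KS.σuOf κ Φ t p O.merged (KS.gT 0 gx κ Φ t p O.merged) (KS.fT 0 fx κ Φ t p O.merged) (sgOf ((1 : Fin 2), sδ))) (sgOf ((1 : Fin 2), sδ)) (KS.yLd κ Φ t p O.merged (KS.gT 0 gx κ Φ t p O.merged) (KS.fT 0 fx κ Φ t p O.merged) 0 (KS.σuOf κ Φ t p O.merged (KS.gT 0 gx κ Φ t p O.merged) (KS.fT 0 fx κ Φ t p O.merged) (sgOf ((1 : Fin 2), sδ))))) hΛ₁3) k hk).2)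
        (KS.hQfY₃_RA κ Φ t p O.merged 0 gx fx hN hκ hnA hMA hσu hσ (KS.yLd κ Φ t p O.merged (KS.gT 0 gx κ Φ t p O.merged) (KS.fT 0 fx κ Φ t p O.merged) 0 (KS.σuOf κ Φ t p O.merged (KS.gT 0 gx κ Φ t p O.merged) (KS.fT 0 fx κ Φ t p O.merged) (sgOf ((1 : Fin 2), sδ)))) (KS.yYof κ Φ t p O.merged (KS.gT 0 gx κ Φ t p O.merged) (KS.fT 0 fx κ Φ t p O.merged) (KS.σuOf κ Φ t p O.merged (KS.gT 0 gx κ Φ t p O.merged) (KS.fT 0 fx κ Φ t p O.merged) (sgOf ((1 : Fin 2), sδ))) (sgOf ((1 : Fin 2), sδ)) (KS.yLd κ Φ t p O.merged (KS.gT 0 gx κ Φ t p O.merged) (KS.fT 0 fx κ Φ t p O.merged) 0 (KS.σuOf κ Φ t p O.merged (KS.gT 0 gx κ Φ t p O.merged) (KS.fT 0 fx κ Φ t p O.merged) (sgOf ((1 : Fin 2), sδ))))) hΛ₁3 hρ.1 hρ.2 hrel hΛ7.2.1)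
        (Skelφ.pt_zero _ _).le (Skelφ.pt_zero _ _).ge (Skelφ.pt_one _ _).le (Skelφ.pt_one _ _).ge
        (fun h => KS.hLgY₁_RA κ Φ t p O.merged 0 gx fx hN hκ hnA hMA hσ (KS.yYof κ Φ t p O.merged (KS.gT 0 gx κ Φ t p O.merged) (KS.fT 0 fx κ Φ t p O.merged) (KS.σuOf κ Φ t p O.merged (KS.gT 0 gx κ Φ t p O.merged) (KS.fT 0 fx κ Φ t p O.merged) (sgOf ((1 : Fin 2), sδ))) (sgOf ((1 : Fin 2), sδ)) (KS.yLd κ Φ t p O.merged (KS.gT 0 gx κ Φ t p O.merged) (KS.fT 0 fx κ Φ t p O.merged) 0 (KS.σuOf κ Φ t p O.merged (KS.gT 0 gx κ Φ t p O.merged) (KS.fT 0 fx κ Φ t p O.merged) (sgOf ((1 : Fin 2), sδ))))) hΛ₁3 h) (fun h => KS.hLgY₂_RA κ Φ t p O.merged 0 gx fx hN hκ hnA hMA hσ (KS.yYof κ Φ t p O.merged (KS.gT 0 gx κ Φ t p O.merged) (KS.fT 0 fx κ Φ t p O.merged) (KS.σuOf κ Φ t p O.merged (KS.gT 0 gx κ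 Φ t p O.merged) (KS.fT 0 fx κ Φ t p O.merged) (sgOf ((1 : Fin 2), sδ))) (sgOf ((1 : Fin 2), sδ)) (KS.yLd κ Φ t p O.merged (KS.gT 0 gx κ Φ t p O.merged) (KS.fT 0 fx κ Φ t p O.merged) 0 (KS.σuOf κ Φ t p O.merged (KS.gT 0 gx κ Φ t p O.merged) (KS.fT 0 fx κ Φ t p O.merged) (sgOf ((1 : Fin 2), sδ))))) hΛ₁3 h)
        (KS.hLgY₃_RA κ Φ t p O.merged 0 gx fx hN hκ hnA hMA hσu hσ (KS.yLd κ Φ t p O.merged (KS.gT 0 gx κ Φ t p O.merged) (KS.fT 0 fx κ Φ t p O.merged) 0 (KS.σuOf κ Φ t p O.merged (KS.gT 0 gx κ Φ t p O.merged) (KS.fT 0 fx κ Φ t p O.merged) (sgOf ((1 : Fin 2), sδ)))) (KS.yYof κ Φ t p O.merged (KS.gT 0 gx κ Φ t p O.merged) (KS.fT 0 fx κ Φ t p O.merged) (KS.σuOf κ Φ t p O.merged (KS.gT 0 gx κ Φ t p O.merged) (KS.fT 0 fx κ Φ t p O.merged) (sgOf ((1 : Fin 2), sδ))) (sgOf ((1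 : Fin 2), sδ)) (KS.yLd κ Φ t p O.merged (KS.gT 0 gx κ Φ t p O.merged) (KS.fT 0 fx κ Φ t p O.merged) 0 (KS.σuOf κ Φ t p O.merged (KS.gT 0 gx κ Φ t p O.merged) (KS.fT 0 fx κ Φ t p O.merged) (sgOf ((1 : Fin 2), sδ))))) hΛ₁3 hρ.1 hρ.2 hrel hΛ7.2.1)
        (KS.hxa_d κ Φ t p O.merged (KS.gT 0 gx κ Φ t p O.merged) (KS.fT 0 fx κ Φ t p O.merged) 0 hσu) (KS.hxb_d κ Φ t p O.merged 0 gx fx hN hκ hσu) hclr hRn (by rw [hfrB.1, hfrB.2.2.2.2.1, hfrB.2.2.2.2.2.2.2.1]; exact hclr₁)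
        (hπ1_of hc1.2.1) (hπ_of hyl.2.1 (by have := Neg.one_le_Kq κ; omega))
        (KS.hclrY_RA κ Φ t p O.merged (KS.gT 0 gx κ Φ t p O.merged) (KS.fT 0 fx κ Φ t p O.merged) 0 hv hnA hσu hσ hs (KS.yLd κ Φ t p O.merged (KS.gT 0 gx κ Φ t p O.merged) (KS.fT 0 fx κ Φ t p O.merged) 0 (KS.σuOf κ Φ t p O.merged (KS.gT 0 gx κ Φ t p O.merged) (KS.fT 0 fx κ Φ t p O.merged) (sgOf ((1 : Fin 2), sδ)))) hx0 _ _ hNy')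
        (KS.hx₂₃_R κ Φ t p O.merged (KS.gT 0 gx κ Φ t p O.merged) (KS.fT 0 fx κ Φ t p O.merged) 0 hnL hv hlay hRAn hσu hσ (KS.yLd κ Φ t p O.merged (KS.gT 0 gx κ Φ t p O.merged) (KS.fT 0 fx κ Φ t p O.merged) 0 (KS.σuOf κ Φ t p O.merged (KS.gT 0 gx κ Φ t p O.merged) (KS.fT 0 fx κ Φ t p O.merged) (sgOf ((1 : Fin 2), sδ)))) (KS.qBd κ Φ t p O.merged 0) hq4dt.1 _)
        (fun k hk => le_trans (KS.hπ3_RA κ Φ t p O.merged (KS.gT 0 gx κ Φ t p O.merged) (KS.fT 0 fx κ Φ t p O.merged) 0 hnL hv hκ hlay (KS.yYof κ Φ t p O.merged (KS.gT 0 gx κ Φ t p O.merged) (KS.fT 0 fx κ Φ t p O.merged) (KS.σuOf κ Φ t p O.merged (KS.gT 0 gx κ Φ t p O.merged) (KS.fT 0 fx κ Φ t p O.merged) (sgOf ((1 : Fin 2), sδ))) (sgOf ((1 : Fin 2), sδ)) (KS.yLd κ Φ t p O.merged (KS.gT 0 gx κ Φ t p O.merged) (KS.fT 0 fx κ Φ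 t p O.merged) 0 (KS.σuOf κ Φ t p O.merged (KS.gT 0 gx κ Φ t p O.merged) (KS.fT 0 fx κ Φ t p O.merged) (sgOf ((1 : Fin 2), sδ))))) hyY _ _ hNy' k hk) hexRπ)
        hclrz hRb₀ hRr₀ hRbπ hR₁b hR₁r
    · -- #### case `o_b ≠ o_L`, flat: the bridge is a top piece of `trφ φL`
      have hΛ₁3 : |KS.Λ₁of κ Φ t p O.merged (KS.gT 0 gx κ Φ t p O.merged) (KS.fT 0 fx κ Φ t p O.merged) (KS.yYof κ Φ t p O.merged (KS.gT 0 gx κ Φ t p O.merged) (KS.fT 0 fx κ Φ t p O.merged) (KS.σuOf κ Φ t p O.merged (KS.gT 0 gx κ Φ t p O.merged) (KS.fT 0 fx κ Φ t p O.merged) (sgOf ((1 : Fin 2), sδ))) (sgOf ((1 : Fin 2), sδ)) (KS.yLt κ Φ t p O.merged (KS.gT 0 gx κ Φ t p O.merged) (KS.fT 0 fx κ Φ t p O.merged) 0 (KS.σuOf κ Φ t p O.merged (KS.gT 0 gx κ Φ t p O.merged) (KS.fT 0 fx κ Φ t p O.merged) (sgOf ((1 : Fin 2), sδ)))))| ≤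 3 * TwoAxis.Para.modulus (nL κ Φ t p O.merged (KS.gT 0 gx κ Φ t p O.merged) (KS.fT 0 fx κ Φ t p O.merged)) (hL κ Φ t p O.merged (KS.gT 0 gx κ Φ t p O.merged) (KS.fT 0 fx κ Φ t p O.merged)) (vL κ Φ t p O.merged (KS.gT 0 gx κ Φ t p O.merged) (KS.fT 0 fx κ Φ t p O.merged)) (Skelφ.NegPrm.vβOf (nL κ Φ t p O.merged (KS.gT 0 gx κ Φ t p O.merged) (KS.fT 0 fx κ Φ t p O.merged)) (hL κ Φ t p O.merged (KS.gT 0 gx κ Φ t p O.merged) (KS.fT 0 fx κ Φ t p O.merged)) (ℓL κ Φ t p O.merged (KS.gT 0 gx κ Φ t p O.merged) (KS.fT 0 fx κ Φ t p O.merged)) (vL κ Φ t p O.merged (KS.gT 0 gx κ Φ t p O.merged) (KS.fT 0 fx κ Φ t p O.merged))) := by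
        have h1 := KS.abs_Λ₁of_yYof κ Φ t p O.merged (KS.gT 0 gx κ Φ t p O.merged) (KS.fT 0 fx κ Φ t p O.merged) hnL (KS.σuOf κ Φ t p O.merged (KS.gT 0 gx κ Φ t p O.merged) (KS.fT 0 fx κ Φ t p O.merged) (sgOf ((1 : Fin 2), sδ))) (sgOf ((1 : Fin 2), sδ)) (KS.yLt κ Φ t p O.merged (KS.gT 0 gx κ Φ t p O.merged) (KS.fT 0 fx κ Φ t p O.merged) 0 (KS.σuOf κ Φ t p O.merged (KS.gT 0 gx κ Φ t p O.merged) (KS.fT 0 fx κ Φ t p O.merged) (sgOf ((1 : Fin 2), sδ))))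
        have h2 := hΛ3.2.2.2
        linarith
      have hNy := KS.NyOfA_spec κ Φ t p O.merged (KS.gT 0 gx κ Φ t p O.merged) (KS.fT 0 fx κ Φ t p O.merged) hN hσ (KS.yYof κ Φ t p O.merged (KS.gT 0 gx κ Φ t p O.merged) (KS.fT 0 fx κ Φ t p O.merged) (KS.σuOf κ Φ t p O.merged (KS.gT 0 gx κ Φ t p O.merged) (KS.fT 0 fx κ Φ t p O.merged) (sgOf ((1 : Fin 2), sδ))) (sgOf ((1 : Fin 2), sδ)) (KS.yLt κ Φ t p O.merged (KS.gT 0 gx κ Φ t p O.merged) (KS.fT 0 fx κ Φ t p O.merged) 0 (KS.σuOf κ Φ t p O.merged (KS.gT 0 gx κ Φ t p O.merged) (KS.fT 0 fx κ Φ t p O.merged) (sgOf ((1 : Fin 2), sδ))))) hΛ₁3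
      have hNy' : (KS.NyOfA κ Φ t p O.merged (KS.gT 0 gx κ Φ t p O.merged) (KS.fT 0 fx κ Φ t p O.merged) (sgOf ((1 : Fin 2), sδ)) (KS.yYof κ Φ t p O.merged (KS.gT 0 gx κ Φ t p O.merged) (KS.fT 0 fx κ Φ t p O.merged) (KS.σuOf κ Φ t p O.merged (KS.gT 0 gx κ Φ t p O.merged) (KS.fT 0 fx κ Φ t p O.merged) (sgOf ((1 : Fin 2), sδ))) (sgOf ((1 : Fin 2), sδ)) (KS.yLt κ Φ t p O.merged (KS.gT 0 gx κ Φ t p O.merged) (KS.fT 0 fx κ Φ t p O.merged) 0 (KS.σuOf κ Φ t p O.merged (KS.gT 0 gx κ Φ t p O.merged) (KS.fT 0 fx κ Φ t p O.merged) (sgOf ((1 : Fin 2), sδ)))))) + 1 ≤ 1000 * Neg.Kq κ := by have := hNy.1; omega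
      have hρ := KS.ρY_bounds κ Φ t p O.merged (KS.gT 0 gx κ Φ t p O.merged) (KS.fT 0 fx κ Φ t p O.merged) hnL (KS.σuOf κ Φ t p O.merged (KS.gT 0 gx κ Φ t p O.merged) (KS.fT 0 fx κ Φ t p O.merged) (sgOf ((1 : Fin 2), sδ))) (sgOf ((1 : Fin 2), sδ))
      have hrel := KS.Λ₀of_yYof κ Φ t p O.merged (KS.gT 0 gx κ Φ t p O.merged) (KS.fT 0 fx κ Φ t p O.merged) (KS.σuOf κ Φ t p O.merged (KS.gT 0 gx κ Φ t p O.merged) (KS.fT 0 fx κ Φ t p O.merged) (sgOf ((1 : Fin 2), sδ))) (sgOf ((1 : Fin 2), sδ)) (KS.yLt κ Φ t p O.merged (KS.gT 0 gx κ Φ t p O.merged) (KS.fT 0 fx κ Φ t p O.merged) 0 (KS.σuOf κ Φ t p O.merged (KS.gT 0 gx κ Φ t p O.merged) (KS.fT 0 fx κ Φ t p O.merged) (sgOf ((1 : Fin 2), sδ))))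
      have hyY := le_trans (KS.yYof_l1 κ Φ t p O.merged (KS.gT 0 gx κ Φ t p O.merged) (KS.fT 0 fx κ Φ t p O.merged) hnL hv hκ hσu hσ (KS.yLt κ Φ t p O.merged (KS.gT 0 gx κ Φ t p O.merged) (KS.fT 0 fx κ Φ t p O.merged) 0 (KS.σuOf κ Φ t p O.merged (KS.gT 0 gx κ Φ t p O.merged) (KS.fT 0 fx κ Φ t p O.merged) (sgOf ((1 : Fin 2), sδ))))) (Nat.add_le_add_right hyl.2.2 _)
      have hclr := KS.hclr_t κ Φ t p O.merged (KS.gT 0 gx κ Φ t p O.merged) (KS.fT 0 fx κ Φ t p O.merged) 0 hσu htop hℓb27'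
      have hx0 : (O.merged.k : ℤ) < (KS.σuOf κ Φ t p O.merged (KS.gT 0 gx κ Φ t p O.merged) (KS.fT 0 fx κ Φ t p O.merged) (sgOf ((1 : Fin 2), sδ))) * (KS.yLt κ Φ t p O.merged (KS.gT 0 gx κ Φ t p O.merged) (KS.fT 0 fx κ Φ t p O.merged) 0 (KS.σuOf κ Φ t p O.merged (KS.gT 0 gx κ Φ t p O.merged) (KS.fT 0 fx κ Φ t p O.merged) (sgOf ((1 : Fin 2), sδ)))) 0 + ((nL κ Φ t p O.merged (KS.gT 0 gx κ Φ t p O.merged) (KS.fT 0 fx κ Φ t p O.merged) : ℕ) : ℤ) := by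
        have h := hclr
        have h1 := Int.natCast_nonneg (KS.qBt κ Φ t p O.merged 0)
        have h2 := Int.natCast_nonneg (KS.RA' κ Φ t p O.merged 0)
        have h3 := Int.natCast_nonneg (nL κ Φ t p O.merged (KS.gT 0 gx κ Φ t p O.merged) (KS.fT 0 fx κ Φ t p O.merged))
        linarith
      obtain ⟨hQb, hFb, hFZ, hbridge⟩ := Skelφ.bridgeData_trTop t hσu (nL κ Φ t p O.merged (KS.gT 0 gx κ Φ t p O.merged) (KS.fT 0 fx κ Φ t p O.merged)) (hL κ Φ t p O.merged (KS.gT 0 gx κ Φ t p O.merged) (KS.fT 0 fx κ Φ t p O.merged)) (ℓL κ Φ t p O.merged (KS.gT 0 gx κ Φ t p O.merged) (KS.fT 0 fx κ Φ t p O.merged)) (KS.RA' κ Φ t p O.merged 0)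
        hnb (KS.hBR κ Φ t p O.merged 0) (KS.ℓBR κ Φ t p O.merged 0) (Rb κ Φ t p O.merged) (KS.vBR κ Φ t p O.merged 0) hZ (hservedB hNy.1) htr hκb hclrb
      exact rootOblTWAt_negBTA_y hAt h1 hp0 hp1 ((1 : Fin 2), sδ) hσu 0 3 (KS.qBt κ Φ t p O.merged 0) (KS.NyOfA κ Φ t p O.merged (KS.gT 0 gx κ Φ t p O.merged) (KS.fT 0 fx κ Φ t p O.merged) (sgOf ((1 : Fin 2), sδ)) (KS.yYof κ Φ t p O.merged (KS.gT 0 gx κ Φ t p O.merged) (KS.fT 0 fx κ Φ t p O.merged) (KS.σuOf κ Φ t p O.merged (KS.gT 0 gx κ Φ t p O.merged) (KS.fT 0 fx κ Φ t p O.merged) (sgOf ((1 : Fin 2), sδ))) (sgOf ((1 : Fin 2), sδ)) (KS.yLt κ Φ t p O.merged (KS.gT 0 gx κ Φ t p O.merged) (KS.fT 0 fx κ Φ t p O.merged) 0 (KS.σuOf κ Φ t p O.merged (KS.gT 0 gx κ Φ t p O.merged) (KS.fT 0 fx κ Φ t p O.merged) (sgOf ((1 : Fin 2), sδ)))))) (KS.qY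 κ Φ t p O.merged (KS.gT 0 gx κ Φ t p O.merged) (KS.fT 0 fx κ Φ t p O.merged) 0) _ (Rb κ Φ t p O.merged) (hLf hNy.1) hflat
        (KS.yLt κ Φ t p O.merged (KS.gT 0 gx κ Φ t p O.merged) (KS.fT 0 fx κ Φ t p O.merged) 0 (KS.σuOf κ Φ t p O.merged (KS.gT 0 gx κ Φ t p O.merged) (KS.fT 0 fx κ Φ t p O.merged) (sgOf ((1 : Fin 2), sδ)))) (KS.yYof κ Φ t p O.merged (KS.gT 0 gx κ Φ t p O.merged) (KS.fT 0 fx κ Φ t p O.merged) (KS.σuOf κ Φ t p O.merged (KS.gT 0 gx κ Φ t p O.merged) (KS.fT 0 fx κ Φ t p O.merged) (sgOf ((1 : Fin 2), sδ))) (sgOf ((1 : Fin 2), sδ)) (KS.yLt κ Φ t p O.merged (KS.gT 0 gx κ Φ t p O.merged) (KS.fT 0 fx κ Φ t p O.merged) 0 (KS.σuOf κ Φ t p O.merged (KS.gT 0 gx κ Φ t p O.merged) (KS.fT 0 fx κ Φ t p O.merged) (sgOf ((1 : Fin 2), sδ))))) (mx κ Φ t p O.merged (KS.gT 0 gx κ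 Φ t p O.merged) (KS.fT 0 fx κ Φ t p O.merged))
        (KS.kit_mem_PR κ Φ t p O.merged 0 Px) hRQ hRB hRQ' hRM hΛRg hkA0 hkA1 ⟨hkAQ' 1, hkAQ' 0⟩ hρπ _ hbOK.2.2 (le_of_eq hfrB.2.2.2.2.2.1.symm) _ _ hQb hFb hFZ hbridge
        (by rw [hfrB.2.2.1, hfrB.2.2.2.1]; exact hB0) hRlπ (by rw [hregB.2.2.1, hregB.2.2.2]; exact hΛR) hΛQ.1 hΛQ.2 hkR0 hkR1 (fun h => absurd h.symm Fin.zero_ne_one) (fun _ => hfR.2)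
        (KS.hprism_R κ Φ t p O.merged (KS.gT 0 gx κ Φ t p O.merged) (KS.fT 0 fx κ Φ t p O.merged) 0 _ _)
        (Skelφ.pt_zero _ _).le (Skelφ.pt_zero _ _).ge (Skelφ.pt_one _ _).le (Skelφ.pt_one _ _).ge
        (KS.hPfX₁σ_RA κ Φ t p O.merged 0 gx fx hN hκ (KS.yLt κ Φ t p O.merged (KS.gT 0 gx κ Φ t p O.merged) (KS.fT 0 fx κ Φ t p O.merged) 0 (KS.σuOf κ Φ t p O.merged (KS.gT 0 gx κ Φ t p O.merged) (KS.fT 0 fx κ Φ t p O.merged) (sgOf ((1 : Fin 2), sδ)))) (KS.qBt κ Φ t p O.merged 0) hq4dt.2 hnA hMA hσu hΛ3.2.2.2 (sgOf ((1 : Fin 2), sδ))) (KS.hPfX₂σ_RA κ Φ t p O.merged 0 gx fx hN hκ (KS.yLt κ Φ t p O.merged (KS.gT 0 gx κ Φ t p O.merged) (KS.fT 0 fx κ Φ t p O.merged) 0 (KS.σuOf κ Φ t p O.merged (KS.gT 0 gx κ Φ t p O.merged) (KS.fT 0 fx κ Φ t p O.merged) (sgOf ((1 : Fin 2), sδ))))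 (KS.qBt κ Φ t p O.merged 0) hq4dt.2 hnA hMA hσu hΛ3.2.2.2 (sgOf ((1 : Fin 2), sδ)))
        (KS.hPfX₃_RA κ Φ t p O.merged 0 gx fx hN hκ (KS.yLt κ Φ t p O.merged (KS.gT 0 gx κ Φ t p O.merged) (KS.fT 0 fx κ Φ t p O.merged) 0 (KS.σuOf κ Φ t p O.merged (KS.gT 0 gx κ Φ t p O.merged) (KS.fT 0 fx κ Φ t p O.merged) (sgOf ((1 : Fin 2), sδ)))) (KS.qBt κ Φ t p O.merged 0) hq4dt.2 hnA hMA hσu hΛ3.2.2.1)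
        (KS.hregY_R κ Φ t p O.merged (KS.gT 0 gx κ Φ t p O.merged) (KS.fT 0 fx κ Φ t p O.merged) 0 hnL hv hlay _ _) (KS.hlastcY_R κ Φ t p O.merged (KS.gT 0 gx κ Φ t p O.merged) (KS.fT 0 fx κ Φ t p O.merged) 0 hnL hv hlay _ _)
        (fun _ _ => (Skelφ.pt_zero _ _).le) (fun _ _ => (Skelφ.pt_zero _ _).ge) (fun _ _ => (Skelφ.pt_one _ _).le) (fun _ _ => (Skelφ.pt_one _ _).ge)
        (fun k hk => ((KS.hQfY_lev_RA κ Φ t p O.merged 0 gx fx hN hκ hnA hMA hσ (KS.yYof κ Φ t p O.merged (KS.gT 0 gx κ Φ t p O.merged) (KS.fT 0 fx κ Φ t p O.merged) (KS.σuOf κ Φ t p O.merged (KS.gT 0 gx κ Φ t p O.merged) (KS.fT 0 fx κ Φ t p O.merged) (sgOf ((1 : Fin 2), sδ))) (sgOf ((1 : Fin 2), sδ)) (KS.yLt κ Φ t p O.merged (KS.gT 0 gx κ Φ t p O.merged) (KS.fT 0 fx κ Φ t p O.merged) 0 (KS.σuOf κ Φ t p O.merged (KS.gT 0 gx κ Φ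 t p O.merged) (KS.fT 0 fx κ Φ t p O.merged) (sgOf ((1 : Fin 2), sδ))))) hΛ₁3) k hk).1) (fun k hk => ((KS.hQfY_lev_RA κ Φ t p O.merged 0 gx fx hN hκ hnA hMA hσ (KS.yYof κ Φ t p O.merged (KS.gT 0 gx κ Φ t p O.merged) (KS.fT 0 fx κ Φ t p O.merged) (KS.σuOf κ Φ t p O.merged (KS.gT 0 gx κ Φ t p O.merged) (KS.fT 0 fx κ Φ t p O.merged) (sgOf ((1 : Fin 2), sδ))) (sgOf ((1 : Fin 2), sδ)) (KS.yLt κ Φ t p O.merged (KS.gT 0 gx κ Φ t p O.merged) (KS.fT 0 fx κ Φ t p O.merged) 0 (KS.σuOf κ Φ t p O.merged (KS.gT 0 gx κ Φ t p O.merged) (KS.fT 0 fx κ Φ t p O.merged) (sgOf ((1 : Fin 2), sδ))))) hΛ₁3) k hk).2)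
        (KS.hQfY₃_RA κ Φ t p O.merged 0 gx fx hN hκ hnA hMA hσu hσ (KS.yLt κ Φ t p O.merged (KS.gT 0 gx κ Φ t p O.merged) (KS.fT 0 fx κ Φ t p O.merged) 0 (KS.σuOf κ Φ t p O.merged (KS.gT 0 gx κ Φ t p O.merged) (KS.fT 0 fx κ Φ t p O.merged) (sgOf ((1 : Fin 2), sδ)))) (KS.yYof κ Φ t p O.merged (KS.gT 0 gx κ Φ t p O.merged) (KS.fT 0 fx κ Φ t p O.merged) (KS.σuOf κ Φ t p O.merged (KS.gT 0 gx κ Φ t p O.merged) (KS.fT 0 fx κ Φ t p O.merged) (sgOf ((1 : Fin 2), sδ))) (sgOf ((1 : Fin 2), sδ)) (KS.yLt κ Φ t p O.merged (KS.gT 0 gx κ Φ t p O.merged) (KS.fT 0 fx κ Φ t p O.merged) 0 (KS.σuOf κ Φ t p O.merged (KS.gT 0 gx κ Φ t p O.merged) (KS.fT 0 fx κ Φ t p O.merged) (sgOf ((1 : Fin 2), sδ))))) hΛ₁3 hρ.1 hρ.2 hrel hΛ7.2.2)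
        (Skelφ.pt_zero _ _).le (Skelφ.pt_zero _ _).ge (Skelφ.pt_one _ _).le (Skelφ.pt_one _ _).ge
        (fun h => KS.hLgY₁_RA κ Φ t p O.merged 0 gx fx hN hκ hnA hMA hσ (KS.yYof κ Φ t p O.merged (KS.gT 0 gx κ Φ t p O.merged) (KS.fT 0 fx κ Φ t p O.merged) (KS.σuOf κ Φ t p O.merged (KS.gT 0 gx κ Φ t p O.merged) (KS.fT 0 fx κ Φ t p O.merged) (sgOf ((1 : Fin 2), sδ))) (sgOf ((1 : Fin 2), sδ)) (KS.yLt κ Φ t p O.merged (KS.gT 0 gx κ Φ t p O.merged) (KS.fT 0 fx κ Φ t p O.merged) 0 (KS.σuOf κ Φ t p O.merged (KS.gT 0 gx κ Φ t p O.merged) (KS.fT 0 fx κ Φ t p O.merged) (sgOf ((1 : Fin 2), sδ))))) hΛ₁3 h) (fun h => KS.hLgY₂_RA κ Φ t p O.merged 0 gx fx hN hκ hnA hMA hσ (KS.yYof κ Φ t p O.merged (KS.gT 0 gx κ Φ t p O.merged) (KS.fT 0 fx κ Φ t p O.merged) (KS.σuOf κ Φ t p O.merged (KS.gT 0 gx κ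 Φ t p O.merged) (KS.fT 0 fx κ Φ t p O.merged) (sgOf ((1 : Fin 2), sδ))) (sgOf ((1 : Fin 2), sδ)) (KS.yLt κ Φ t p O.merged (KS.gT 0 gx κ Φ t p O.merged) (KS.fT 0 fx κ Φ t p O.merged) 0 (KS.σuOf κ Φ t p O.merged (KS.gT 0 gx κ Φ t p O.merged) (KS.fT 0 fx κ Φ t p O.merged) (sgOf ((1 : Fin 2), sδ))))) hΛ₁3 h)
        (KS.hLgY₃_RA κ Φ t p O.merged 0 gx fx hN hκ hnA hMA hσu hσ (KS.yLt κ Φ t p O.merged (KS.gT 0 gx κ Φ t p O.merged) (KS.fT 0 fx κ Φ t p O.merged) 0 (KS.σuOf κ Φ t p O.merged (KS.gT 0 gx κ Φ t p O.merged) (KS.fT 0 fx κ Φ t p O.merged) (sgOf ((1 : Fin 2), sδ)))) (KS.yYof κ Φ t p O.merged (KS.gT 0 gx κ Φ t p O.merged) (KS.fT 0 fx κ Φ t p O.merged) (KS.σuOf κ Φ t p O.merged (KS.gT 0 gx κ Φ t p O.merged) (KS.fT 0 fx κ Φ t p O.merged) (sgOf ((1 : Fin 2), sδ))) (sgOf ((1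 : Fin 2), sδ)) (KS.yLt κ Φ t p O.merged (KS.gT 0 gx κ Φ t p O.merged) (KS.fT 0 fx κ Φ t p O.merged) 0 (KS.σuOf κ Φ t p O.merged (KS.gT 0 gx κ Φ t p O.merged) (KS.fT 0 fx κ Φ t p O.merged) (sgOf ((1 : Fin 2), sδ))))) hΛ₁3 hρ.1 hρ.2 hrel hΛ7.2.2)
        (KS.hxa_t κ Φ t p O.merged (KS.gT 0 gx κ Φ t p O.merged) (KS.fT 0 fx κ Φ t p O.merged) 0 hσu) (KS.hxb_t κ Φ t p O.merged 0 gx fx hN hκ hσu htop) hclr hRn (by rw [hfrB.2.2.1, hfrB.2.2.2.2.2.1, hfrB.2.2.2.2.2.2.2.2.1]; exact hclr₁)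
        (hπ1_of hc1.2.2) (hπ_of hyl.2.2 (by have := Neg.one_le_Kq κ; omega))
        (KS.hclrY_RA κ Φ t p O.merged (KS.gT 0 gx κ Φ t p O.merged) (KS.fT 0 fx κ Φ t p O.merged) 0 hv hnA hσu hσ hs (KS.yLt κ Φ t p O.merged (KS.gT 0 gx κ Φ t p O.merged) (KS.fT 0 fx κ Φ t p O.merged) 0 (KS.σuOf κ Φ t p O.merged (KS.gT 0 gx κ Φ t p O.merged) (KS.fT 0 fx κ Φ t p O.merged) (sgOf ((1 : Fin 2), sδ)))) hx0 _ _ hNy')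
        (KS.hx₂₃_R κ Φ t p O.merged (KS.gT 0 gx κ Φ t p O.merged) (KS.fT 0 fx κ Φ t p O.merged) 0 hnL hv hlay hRAn hσu hσ (KS.yLt κ Φ t p O.merged (KS.gT 0 gx κ Φ t p O.merged) (KS.fT 0 fx κ Φ t p O.merged) 0 (KS.σuOf κ Φ t p O.merged (KS.gT 0 gx κ Φ t p O.merged) (KS.fT 0 fx κ Φ t p O.merged) (sgOf ((1 : Fin 2), sδ)))) (KS.qBt κ Φ t p O.merged 0) hq4dt.2 _)
        (fun k hk => le_trans (KS.hπ3_RA κ Φ t p O.merged (KS.gT 0 gx κ Φ t p O.merged) (KS.fT 0 fx κ Φ t p O.merged) 0 hnL hv hκ hlay (KS.yYof κ Φ t p O.merged (KS.gT 0 gx κ Φ t p O.merged) (KS.fT 0 fx κ Φ t p O.merged) (KS.σuOf κ Φ t p O.merged (KS.gT 0 gx κ Φ t p O.merged) (KS.fT 0 fx κ Φ t p O.merged) (sgOf ((1 : Fin 2), sδ))) (sgOf ((1 : Fin 2), sδ)) (KS.yLt κ Φ t p O.merged (KS.gT 0 gx κ Φ t p O.merged) (KS.fT 0 fx κ Φ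 t p O.merged) 0 (KS.σuOf κ Φ t p O.merged (KS.gT 0 gx κ Φ t p O.merged) (KS.fT 0 fx κ Φ t p O.merged) (sgOf ((1 : Fin 2), sδ))))) hyY _ _ hNy' k hk) hexRπ)
        hclrz hRb₀ hRr₀ hRbπ hR₁b hR₁r

end AtR

end NegB

end PlanarSkeletonNeg

end Summit.CriticalPhenomena.PercolationContinuityZ3.Theorems.Transplant

end
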